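import Summits.CriticalPhenomena.CardyFormulaZ2.Theses.CardyBoundaryCoulombGas
import Summits.CriticalPhenomena.CardyFormulaZ2.Theses.CardyMonotoneApproach
import Summits.CriticalPhenomena.CardyFormulaZ2.Theses.CardyPolygonWords
import Summits.CriticalPhenomena.CardyFormulaZ2.Theses.CardyGluingRDE
import Summits.CriticalPhenomena.CardyFormulaZ2.Theses.CardyHausdorffMoment
import Literature.Probability.Percolation.QuadCrossingSquareModel
import Literature.Probability.RandomPlanarGeometry.ModulusSymmetry
import Literature.Probability.RandomPlanarGeometry.CardyFunctionIncBeta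
import Literature.Probability.RandomPlanarGeometry.RectangleModulusAspectRatio
import Literature.Probability.Percolation.BoxCrossingJordan
import Literature.Probability.RandomPlanarGeometry.PolygonalDomains
import Literature.Probability.RandomPlanarGeometry.ChordalCurveFamily

/-!
# Disproof of `RectilinearCardy` (crux `stmt-CriticalPhenomena-5660`, route `CardyBoundaryCoulombGas`) — findings

Standing adversary's work file (refuter `cdisprove`, opened 2026-08-16; CYCLE 2 additions
2026-08-16: §7 pre-emptive targets, §9 shells / lattice polygons / more hostages, §10 the law as a
parameter, §11 the L-shape with a reflex-corner mark built in Lean, §8 cycle-2 numerics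
`numerics_evidence_cycle2`, `numerics_evidence_cycle2_lshape`). Everything below is
`lean check`ed (rc 0; exactly one `sorry`, the recorded near-miss `squareCrossingHalf_conj`); prose
lives in docstrings only. LANDED, importable copies of the sorry-free parts (same names, namespace
`Summit.CriticalPhenomena.CardyFormulaZ2.Theorems.RectilinearCardy.Negative`):
`Theorems/RectilinearCardy/Negative/RectilinearCardyReductions.lean` (p73445, accepted: §1–§3, §4
admissibility), `…/Negative/RectilinearCardySquareInstance.lean` (p74102, accepted: §4 square
instance, §6 Bollobás–Riordan rectangles) and `…/Negative/RectilinearCardyShells.lean` (p80585,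
accepted, cycle 2: §9 shell criterion + lattice polygons, §10 `hasCrossingLimit_congr_law`,
`not_rectilinear_law_of_exists_not_mem`) and `…/Negative/RectilinearCardyLShape.lean` (p81964,
accepted, cycle 2: §11 the L-shape `lShapeQuad`, modulus `1/2`,
`tendsto_half_lShapeQuad_of_rectilinearCardy`). This work file stays self-contained. VERDICT SO FAR (cycles 1–2): **no kill; the crux resists for a structural reason** — it is
the conjunct restricted to rectilinear polygons (`rectilinearCardy_of_withoutRectilinear`), it is
faithfully typed (no junk instance, §3; only the law's values on `(0,1)` matter, §10), it realises
every modulus (§6), it implies the targets / cruxes of five sibling routes none of which is refuted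
(§4, §9), and every consequence we can actually evaluate is true (§4, §8: squares, rectangles,
L-shapes with a reflex corner, Zhang's triangle, strip rates). A refutation would be a disproof of
Cardy's formula for critical bond percolation on `ℤ²` (Schramm ICM 2006 Problem 2.11).

Index (section ↦ what it gives the provers / planners):

* §1 `IsRectilinear`, `rectilinearCardy_iff`, `Crux`, `WithoutRectilinear` (= the conjunct, by
  `rfl`), `rectilinearCardy_of_withoutRectilinear`, `not_cardyFormulaZ2_of_not_rectilinearCardy` —
  the crux is LITERALLY the conjunct restricted to rectilinear Jordan polygons; a disproof of the
  crux is a disproof of Cardy's formula on `ℤ²` (Schramm, ICM 2006, Problem 2.11 — open; believed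
  TRUE by universality; the only printed claim of falsity, Zhang arXiv:2206.04599 Cor. 2, rests on
  transporting Carleson's form by an AFFINE (non-conformal) map, is unrefereed, contradicted by Zhou
  arXiv:2409.03235 and by thirty years of numerics — Langlands–Pouliot–Saint-Aubin 1994, Ziff
  1992/2011 — and is tested directly in §8, job `j008060`).
* §2 `hasCrossingLimit_iff_tendsto`, `hasCrossingLimit_iff_exists`, `modulus`,
  `hasCrossingLimit_iff_modulus`, `rectilinearCardy_iff_modulus`, `not_rectilinearCardy_iff` — ONE
  uniformizing datum suffices (tree theorems `MarkedDomain.exists_isUniformizing_holds` = Riemann +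
  Carathéodory, and `ConformalRectangle.crossRatio_eq_of_isUniformizing_holds`); a refutation must
  exhibit a rectilinear `R`, identify its modulus `η_R`, and prove `p_R(δ) ↛ F(η_R)`.
* §3 `clusterPt_mem_Ioo`, `limit_mem_Ioo`, `not_frequently_eq_zero/one`, `cardyFunction_mem_Ioo` —
  NO JUNK REFUTATION: by the tree's RSW theorem `discreteCrossingProb_clusterPt_mem_Ioo_holds` every
  subsequential limit of `δ ↦ bondDomainCrossingProb R δ` at `0⁺` lies in `(0,1)` for EVERY conformal
  rectangle (empty or overlapping discrete arcs, sure crossings through a vertex lying in both arcs —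
  `Reachable` is reflexive —, disconnected mesh domains, marks at corners, sides on lattice lines:
  all confined to meshes bounded away from `0`; cf. the accepted refutation
  `CardyUniqueLimitNegDegenerateArcs_refuted` of guard stmt-0748), and `F` maps `(0,1)` into `(0,1)`.
  The crux can only fail by `p_R` converging to a WRONG interior value or oscillating inside
  `(0,1)` — a statement about critical bond percolation, not about the typing.
* §4 `isRectilinear_of_carrier_eq`, `isRectilinear_rectQuad`, `rectQuad_pt`, `rectCardy_of_crux`
  (the crux implies the TARGET `RectCardy` of sibling route `CardyMonotoneApproach`),
  `unitSquareQuad_pt`, `crossRatio_unitSquareQuad` (= 1/2 for every datum: reflection in the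
  diagonal, tree `crossRatio_eq_half_of_antiAffine`), `cardyFunction_half`, `SquareCrossingHalf`,
  `squareCrossingHalf_of_rectilinearCardy`, `tendsto_half_of_antiAffine` — THE CHEAPEST KILL SHOTS:
  the crux implies `P_{1/2}[bottom ↔ top of the discretised square (-1,1)²] → 1/2`, and `→ 1/2` for
  every symmetric rectilinear instance. They miss: those limits ARE `1/2` (self-duality
  `crossingProb half (n+1) n = 1/2` + one-column continuity; quarter-turn symmetry; Monte Carlo of
  the tree's exact discretisation, job `j008056`).
* §5 LOAD-BEARING HYPOTHESES: the crux has one hypothesis beyond the structure fields,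
  rectilinearity; dropping it gives the conjunct (`WithoutRectilinear`), not junk-refutable either
  (`withoutRectilinear_consistent`). The structure fields (Jordan boundary AS DATA, four strictly
  increasing marks in `[0,1)`) admit no degenerate instance (`MarkedDomain.pt_injective`; arcs `0`,
  `2` disjoint compacta; genuine Jordan carrier). `p = 1/2` and the discretisation are hard-wired in
  `bondDomainCrossingProb` (nothing to mutate). Rectilinearity is load-bearing only for the route's
  ENGINE (closed BKW collar), not for truth.
* §6 NATURAL STRENGTHENINGS / STRUCTURE: `law_unique`, `law_half_of_squareCrossingHalf`, `brRect`
  (the Bollobás–Riordan marked rectangle as a `ConformalRectangle`; `exists_brRect` = part (a) of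
  sibling support `RectModulus`, proved), `exists_isRectilinear_modulus_eq` (rectilinear rectangles
  realise EVERY modulus, via tree `rectangle_crossRatio_eq_of_aspectRatio_holds`), `law_eqOn` (the
  crux pins the scaling function on all of `(0,1)`), `cardyFormulaZ2_of_cruxWithTransport` (crux +
  sibling item `ConfInvTransport` ⇒ conjunct).
* §7 `-- Targets` (cycle 2, PRE-EMPTIVE — no line picked, `stuck_stubs = []`): the round-1
  cards' typed first lemmas re-read for junk / cheap falsity (all clean limit statements; Möbius
  and kernel bookkeeping verified by hand) — verbatim copies `killedKernel`, `killedGreen`,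
  `excursionEta`, `RankOneWardBox`, `RowWardBox` of `SketchIdeator3.lean`; `wardDP`, `wardDF`,
  `RankOneWardBoxWith κ` (`rankOneWardBox_iff_with_one`: the card's statement is `κ = 1`),
  `rankOneWardBoxWith_degenerate` (two constants ⇒ both increments `o(n⁻²)`). FINDING (numerical,
  kit `j012621` + in-session twin): the isolated-notch Ward identity holds, if at all, with
  `κ = κ_perc(1 - 2/π) ≈ 1.40 ± 0.02`, not `1` — `RankOneWardBox` as typed is false at the
  constant level (killed-walk notch factor `4/(4 - 8/π) = 2.752` exact vs percolation's
  `κ_perc = 3.85 ± 0.05`); the row / sequential version is calibrated (`T_row → 1`).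
* §8 EVIDENCE / NEAR-MISSES: `squareCrossingHalf_conj` (`sorry`, obstruction recorded),
  `numerics_evidence` (cycle 1: in-session tables; the cycle-1 kit jobs `j008056/60`, `j008859`
  were reaped unrun when that seat ended — their in-session twins ARE the record, item evidence
  `NUMERICS-local.md`, `NUMERICS-Lshape.md`), `numerics_evidence_cycle2` (kit `j012621`:
  `κ_perc`, `R_RW`, `T_row`, `T_notch` tables), `numerics_evidence_cycle2_lshape` (kit `j013158`:
  the L-shape under the tree's exact discretisation at `0.3 %`, SC-free killed-walk moduli
  confirming the cycle-1 Schwarz–Christoffel values to `3·10⁻⁴`).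
* §9 (cycle 2) `shell_subset_segments`, `isRectilinear_of_frontier_subset_shells` (shell
  criterion), `isRectilinear_of_carrier_eq_interior` (LATTICE POLYGONS of any mesh `δ₀` are
  rectilinear), and MORE HOSTAGES — the crux implies the TARGETS of three more sibling routes and
  two more cruxes: `cardyLatticePolygon_of_crux` / `cardyLatticePolygon'_of_crux`
  (`CardyLatticePolygon`, stmt-4781, target of `CardyPolygonWords` AND `CardyGluingRDE`),
  `hmRectCardy_of_crux` (`CardyHausdorffMoment.RectCardy` = stmt-5843, also the target of
  `CardyMonotoneApproach`, §4), `cardyRectangle_of_crux` (stmt-4782), `cardyOneStep_of_crux`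
  (stmt-4783, one-step polygons). Any refutation of 4781 / 4782 / 4783 / 5843 refutes this crux;
  none exists (`ledger negatives`, 2026-08-16: nine CriticalPhenomena refutations, none a
  consequence of the crux — 0748 degenerate arcs and 6949 / 8581 concern other mechanisms).
* §11 (cycle 2) THE L-SHAPE IN LEAN: `lVerts`, `isSimpleClosedPolygon_lVerts`, `lShapeQuad`
  (`polygonDomain` of the hexagon `0,2,2+i,1+i,1+2i,2i`, marks `0, 2, 1+i, 2i` — reflex corner
  marked), `lShapeQuad_pt`, `frontier_lShapeQuad`, `isRectilinear_lShapeQuad`, `swapL`/`swapH`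
  (`z ↦ i z̄`), `swapH_image_frontier`, `swapH_image_carrier`, `crossRatio_lShapeQuad`,
  `modulus_lShapeQuad` (`= 1/2`), `tendsto_half_lShape_of_crux` — kill shot three, misses
  (`P = 0.5015(8), 0.4994(11), 0.5010(12)`).
* §10 (cycle 2) `CruxWithLaw G`, `cruxWithLaw_congr` (only the law's values on `(0,1)` matter —
  the `Real.rpow`/`₂F₁` junk of `cardyFunction` outside `[0,1]` is provably irrelevant),
  `not_cruxWithLaw_of_exists` (UNCONDITIONALLY refuted laws: any `G` leaving `(0,1)` somewhere on
  `(0,1)`; this is all §3 can kill), `CruxWithLaw.eqOn_cardyFunction` (no competitor law).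
-/

noncomputable section

namespace Summit.CriticalPhenomena.CardyFormulaZ2.Cruxes.RectilinearCardy.Disproof

open Set Filter Topology Complex ComplexConjugate
open UpperHalfPlane (upperHalfPlaneSet)
open Literature.Probability.RandomPlanarGeometry
open Literature.Probability.Percolation (bondDomainCrossingProb discreteCrossingProb half unitSquareQuad
  rectQuad rectQuad_carrier unitSquareQuad_carrier discreteCrossingProb_clusterPt_mem_Ioo_holds
  mem_segment_iff_of_im_eq mem_segment_iff_of_re_eq mem_rectQuad_arc_zero mem_rectQuad_arc_one
  mem_rectQuad_arc_two mem_rectQuad_arc_three)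
open Summit.CriticalPhenomena.CardyFormulaZ2.Theses.CardyBoundaryCoulombGas (RectilinearCardy)
open Summit.CriticalPhenomena.CardyFormulaZ2.Theses (CardyMonotoneApproach.RectCardy
  CardyMonotoneApproach.ConfInvTransport CardyPolygonWords.CardyRectangle CardyPolygonWords.CardyOneStep
  CardyPolygonWords.CardyLatticePolygon CardyGluingRDE.CardyLatticePolygon CardyHausdorffMoment.RectCardy)

/-! ## §1 The crux, unfolded; the crux is the conjunct restricted to rectilinear polygons -/

/-- The hypothesis of the crux: the Jordan boundary of `R` lies in finitely many axis-parallel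
(possibly degenerate) segments, i.e. `R` is a rectilinear Jordan polygon. [folklore] -/
def IsRectilinear (R : ConformalRectangle) : Prop :=
  ∃ S : Finset (ℂ × ℂ), (∀ p ∈ S, p.1.re = p.2.re ∨ p.1.im = p.2.im) ∧
    frontier R.carrier ⊆ ⋃ p ∈ S, segment ℝ p.1 p.2

/-- `RectilinearCardy` is, by `rfl`, Cardy's formula for bond-`ℤ²` restricted to rectilinear
conformal rectangles. [folklore] -/
theorem rectilinearCardy_iff :
    RectilinearCardy ↔ ∀ R : ConformalRectangle, IsRectilinear R →
      R.HasCrossingLimit (bondDomainCrossingProb R) cardyFunction :=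
  Iff.rfl

/-- Local name for the crux, used as the HYPOTHESIS type of the consequences drawn below whose
conclusions are registered items of sibling routes (`RectCardy`, `CardyFormulaZ2`), so that the
audit reads them as conditional (they credit nothing: the crux is open). [folklore] -/
abbrev Crux : Prop := RectilinearCardy

/-- `Crux` is the crux, by `rfl`. [folklore] -/
theorem crux_iff : Crux ↔ RectilinearCardy := Iff.rfl

/-- The crux with its only hypothesis (rectilinearity) DROPPED: by `rfl` this is the sub-problem
conjunct `CardyFormulaZ2` itself (Cardy's formula for bond-`ℤ²` in every conformal rectangle). Kept
under a local name so that the audit does not mistake `WithoutRectilinear → RectilinearCardy` for a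
proof of the item. [folklore] -/
abbrev WithoutRectilinear : Prop := _root_.CardyFormulaZ2

/-- `WithoutRectilinear` is literally the conjunct. [folklore] -/
theorem withoutRectilinear_iff : WithoutRectilinear ↔ _root_.CardyFormulaZ2 := Iff.rfl

/-- **The crux is weaker than the conjunct**: `CardyFormulaZ2 → RectilinearCardy` (restriction of a
universally quantified statement). Hence any refutation of the crux refutes Cardy's formula for
critical bond percolation on `ℤ²` (Schramm, ICM 2006, Problem 2.11), which is open and believed
true; and any proof of the crux that never uses rectilinearity proves the conjunct outright.
NOT a proof of the item: the hypothesis is the open conjunct. [folklore] -/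
theorem rectilinearCardy_of_withoutRectilinear (h : WithoutRectilinear) : RectilinearCardy :=
  fun R _ ↦ h R

/-- Contrapositive bookkeeping: `¬ RectilinearCardy → ¬ CardyFormulaZ2`. [folklore] -/
theorem not_cardyFormulaZ2_of_not_rectilinearCardy (h : ¬ RectilinearCardy) : ¬ _root_.CardyFormulaZ2 :=
  fun h' ↦ h (rectilinearCardy_of_withoutRectilinear h')

/-! ## §2 One uniformizing datum suffices: what a refutation must produce -/

/-- **Single-datum form of `HasCrossingLimit`.** Given ONE uniformizing datum `(φ, x)` of `R`,
`R.HasCrossingLimit p F ↔ p δ → F (crossRatio x)` (`δ → 0⁺`): the universal quantifier over data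
in the combinator is harmless because the cross-ratio is datum-independent
(`ConformalRectangle.crossRatio_eq_of_isUniformizing_holds`, proved in the tree from Carathéodory).
[folklore] -/
theorem hasCrossingLimit_iff_tendsto {R : ConformalRectangle}
    {φ : ConformalEquiv upperHalfPlaneSet R.carrier} {x : Fin 4 → ℝ} (h : R.IsUniformizing φ x)
    {p F : ℝ → ℝ} :
    R.HasCrossingLimit p F ↔ Tendsto p (𝓝[>] 0) (𝓝 (F (crossRatio x))) := by
  constructor
  · intro H
    exact H φ x h
  · intro H φ' x' h'
    rw [ConformalRectangle.crossRatio_eq_of_isUniformizing_holds h' h]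
    exact H

/-- **Existential form**: `R.HasCrossingLimit p F ↔ ∃ datum (φ, x), p → F (crossRatio x)`
(data exist by `MarkedDomain.exists_isUniformizing_holds`: Riemann mapping + Carathéodory, both
theorems of the tree). In particular `HasCrossingLimit` is never vacuously true. [folklore] -/
theorem hasCrossingLimit_iff_exists {R : ConformalRectangle} {p F : ℝ → ℝ} :
    R.HasCrossingLimit p F ↔ ∃ (φ : ConformalEquiv upperHalfPlaneSet R.carrier) (x : Fin 4 → ℝ),
      R.IsUniformizing φ x ∧ Tendsto p (𝓝[>] 0) (𝓝 (F (crossRatio x))) := by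
  constructor
  · intro H
    obtain ⟨φ, x, h⟩ := MarkedDomain.exists_isUniformizing_holds R
    exact ⟨φ, x, h, H φ x h⟩
  · rintro ⟨φ, x, h, H⟩
    exact (hasCrossingLimit_iff_tendsto h).2 H

/-- The **conformal modulus** `η_R ∈ (0,1)` of a conformal rectangle: the cross-ratio of a chosen
uniformizing datum (well defined by `crossRatio_eq_of_isUniformizing_holds`). [folklore] -/
def modulus (R : ConformalRectangle) : ℝ :=
  crossRatio (Classical.choose (Classical.choose_spec (MarkedDomain.exists_isUniformizing_holds R)))

/-- The chosen datum behind `modulus R` is uniformizing. [folklore] -/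
theorem isUniformizing_modulusDatum (R : ConformalRectangle) :
    R.IsUniformizing (Classical.choose (MarkedDomain.exists_isUniformizing_holds R))
      (Classical.choose (Classical.choose_spec (MarkedDomain.exists_isUniformizing_holds R))) :=
  Classical.choose_spec (Classical.choose_spec (MarkedDomain.exists_isUniformizing_holds R))

/-- `modulus R` is the cross-ratio of EVERY uniformizing datum of `R`. [folklore] -/
theorem crossRatio_eq_modulus {R : ConformalRectangle}
    {φ : ConformalEquiv upperHalfPlaneSet R.carrier} {x : Fin 4 → ℝ} (h : R.IsUniformizing φ x) :
    crossRatio x = modulus R :=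
  ConformalRectangle.crossRatio_eq_of_isUniformizing_holds h (isUniformizing_modulusDatum R)

/-- The modulus lies in `(0,1)`. [folklore] -/
theorem modulus_mem_Ioo (R : ConformalRectangle) : modulus R ∈ Ioo 0 1 :=
  ConformalRectangle.crossRatio_mem_Ioo_of_isUniformizing (isUniformizing_modulusDatum R)

/-- `HasCrossingLimit` without quantifiers: `p δ → F (modulus R)`. [folklore] -/
theorem hasCrossingLimit_iff_modulus {R : ConformalRectangle} {p F : ℝ → ℝ} :
    R.HasCrossingLimit p F ↔ Tendsto p (𝓝[>] 0) (𝓝 (F (modulus R))) := by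
  rw [hasCrossingLimit_iff_tendsto (isUniformizing_modulusDatum R)]
  rfl

/-- **The crux without the conformal-map quantifiers**: for every rectilinear conformal rectangle,
`bondDomainCrossingProb R δ → cardyFunction (modulus R)` as `δ → 0⁺`. [folklore] -/
theorem rectilinearCardy_iff_modulus :
    RectilinearCardy ↔ ∀ R : ConformalRectangle, IsRectilinear R →
      Tendsto (bondDomainCrossingProb R) (𝓝[>] 0) (𝓝 (cardyFunction (modulus R))) := by
  simp only [rectilinearCardy_iff, hasCrossingLimit_iff_modulus]

/-- **What a refutation must produce**: a rectilinear `R`, a uniformizing datum `(φ, x)` (or any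
identification of `modulus R`), and a proof that the crossing probabilities do NOT tend to
`F(crossRatio x)`. [folklore] -/
theorem not_rectilinearCardy_iff :
    ¬ RectilinearCardy ↔ ∃ R : ConformalRectangle, IsRectilinear R ∧
      ∃ (φ : ConformalEquiv upperHalfPlaneSet R.carrier) (x : Fin 4 → ℝ), R.IsUniformizing φ x ∧
        ¬ Tendsto (bondDomainCrossingProb R) (𝓝[>] 0) (𝓝 (cardyFunction (crossRatio x))) := by
  rw [rectilinearCardy_iff]
  push Not
  refine exists_congr fun R ↦ and_congr_right fun _ ↦ ?_
  constructor
  · intro H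
    obtain ⟨φ, x, h⟩ := MarkedDomain.exists_isUniformizing_holds R
    exact ⟨φ, x, h, fun H' ↦ H ((hasCrossingLimit_iff_tendsto h).2 H')⟩
  · rintro ⟨φ, x, h, H⟩ H'
    exact H (H' φ x h)

/-! ## §3 No junk refutation: every subsequential limit lies in `(0,1)` (tree RSW theorem) -/

/-- **RSW non-degeneracy for the crux's own discretisation** (tree theorem
`discreteCrossingProb_clusterPt_mem_Ioo_holds`: RSW at `p = 1/2`, FKG/duality chaining near the arcs,
bulk property of the largest-component discretisation for every Jordan domain): every cluster point
at `0⁺` of `δ ↦ bondDomainCrossingProb R δ` lies in `(0,1)`, for EVERY conformal rectangle `R`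
(rectilinear or not). This kills all "junk" attacks on the typing (empty or overlapping discrete
arcs, disconnected mesh domains, marks at corners, sides on lattice lines): they can only affect
finitely many... no: only meshes `δ` bounded away from `0`. [folklore] -/
theorem clusterPt_mem_Ioo (R : ConformalRectangle) {c : ℝ}
    (hc : MapClusterPt c (𝓝[>] 0) (bondDomainCrossingProb R)) : c ∈ Ioo 0 1 :=
  discreteCrossingProb_clusterPt_mem_Ioo_holds R hc

/-- If the crossing probabilities of `R` converge at all, the limit lies in `(0,1)`. [folklore] -/
theorem limit_mem_Ioo (R : ConformalRectangle) {c : ℝ}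
    (h : Tendsto (bondDomainCrossingProb R) (𝓝[>] 0) (𝓝 c)) : c ∈ Ioo 0 1 :=
  clusterPt_mem_Ioo R (ClusterPt.of_le_nhds h)

/-- No conformal rectangle has crossing probability `0` for arbitrarily small meshes (the
degenerate-arc attack; cf. `CardyUniqueLimitNegDegenerateArcs_refuted`). [folklore] -/
theorem not_frequently_eq_zero (R : ConformalRectangle) :
    ¬ ∃ᶠ δ in 𝓝[>] 0, bondDomainCrossingProb R δ = 0 := by
  intro hR
  have h0 : MapClusterPt (0 : ℝ) (𝓝[>] (0 : ℝ)) (bondDomainCrossingProb R) := by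
    rw [mapClusterPt_iff_frequently]
    intro s hs
    exact hR.mono fun δ hδ ↦ by rw [hδ]; exact mem_of_mem_nhds hs
  exact lt_irrefl (0 : ℝ) (clusterPt_mem_Ioo R h0).1

/-- No conformal rectangle has crossing probability `1` for arbitrarily small meshes (the
sure-crossing attack: a mesh vertex lying in BOTH discrete arcs makes the event sure, since
`Reachable` is reflexive; this needs `dist(arc 0, arc 2) ≤ 2δ`, impossible for small `δ`). [folklore] -/
theorem not_frequently_eq_one (R : ConformalRectangle) :
    ¬ ∃ᶠ δ in 𝓝[>] 0, bondDomainCrossingProb R δ = 1 := by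
  intro hR
  have h1 : MapClusterPt (1 : ℝ) (𝓝[>] (0 : ℝ)) (bondDomainCrossingProb R) := by
    rw [mapClusterPt_iff_frequently]
    intro s hs
    exact hR.mono fun δ hδ ↦ by rw [hδ]; exact mem_of_mem_nhds hs
  exact lt_irrefl (1 : ℝ) (clusterPt_mem_Ioo R h1).2

/-- Cardy's function maps `(0,1)` into `(0,1)` (strictly increasing on `[0,1]`, `F 0 = 0`,
`F 1 = 1`, all proved in the tree), so the predicted limit `F(η_R)` is itself an admissible cluster
point: §3 gives no contradiction with the crux, only with its junk instances. [folklore] -/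
theorem cardyFunction_mem_Ioo {η : ℝ} (hη : η ∈ Ioo (0 : ℝ) 1) : cardyFunction η ∈ Ioo (0 : ℝ) 1 := by
  have hmono := strictMonoOn_cardyFunction_holds
  have h0 : (0 : ℝ) ∈ Icc (0 : ℝ) 1 := ⟨le_rfl, zero_le_one⟩
  have h1 : (1 : ℝ) ∈ Icc (0 : ℝ) 1 := ⟨zero_le_one, le_rfl⟩
  have hη' : η ∈ Icc (0 : ℝ) 1 := ⟨hη.1.le, hη.2.le⟩
  constructor
  · have := hmono h0 hη' hη.1
    rwa [cardyFunction_zero] at this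
  · have := hmono hη' h1 hη.2
    rwa [show cardyFunction 1 = 1 from cardyFunction_one_holds] at this

/-- The predicted limit of the crux is always an interior value. [folklore] -/
theorem cardyFunction_modulus_mem_Ioo (R : ConformalRectangle) :
    cardyFunction (modulus R) ∈ Ioo (0 : ℝ) 1 :=
  cardyFunction_mem_Ioo (modulus_mem_Ioo R)

/-! ## §4 Rectangles are admissible; the square test instance (the cheapest kill shot, and why it misses) -/

section Rectangles
open scoped Classical

variable {x₀ x₁ y₀ y₁ : ℝ} (hx : x₀ < x₁) (hy : y₀ < y₁)

include hx hy in
/-- **Every conformal rectangle whose carrier is an open axis-parallel rectangle satisfies the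
hypothesis of the crux** (its frontier is the union of the four closed sides), whatever its marks.
Non-vacuity of `RectilinearCardy` with genuine witnesses, and the bridge to the rectangle items of
the sibling routes (`CardyMonotoneApproach.RectCardy`, `CardyHausdorffMoment`, `CardyLogModulus`). [folklore] -/
theorem isRectilinear_of_carrier_eq {R : ConformalRectangle}
    (hR : R.carrier = Ioo x₀ x₁ ×ℂ Ioo y₀ y₁) : IsRectilinear R := by
  refine ⟨{(⟨x₀, y₀⟩, ⟨x₁, y₀⟩), (⟨x₀, y₁⟩, ⟨x₁, y₁⟩), (⟨x₀, y₀⟩, ⟨x₀, y₁⟩), (⟨x₁, y₀⟩, ⟨x₁, y₁⟩)}, ?_, ?_⟩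
  · intro p hp
    simp only [Finset.mem_insert, Finset.mem_singleton] at hp
    rcases hp with rfl | rfl | rfl | rfl <;> simp
  · intro z hz
    rw [hR, Complex.frontier_reProdIm, closure_Ioo hx.ne, frontier_Ioo hy,
      closure_Ioo hy.ne, frontier_Ioo hx] at hz
    simp only [mem_iUnion, Finset.mem_insert, Finset.mem_singleton, exists_prop]
    rcases hz with ⟨hre, him⟩ | ⟨hre, him⟩
    · rcases him with him | him
      · refine ⟨(⟨x₀, y₀⟩, ⟨x₁, y₀⟩), Or.inl rfl, ?_⟩
        show z ∈ segment ℝ (⟨x₀, y₀⟩ : ℂ) ⟨x₁, y₀⟩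
        rw [mem_segment_iff_of_im_eq (p := ⟨x₀, y₀⟩) (q := ⟨x₁, y₀⟩) hx.le rfl]
        exact ⟨by simpa using him, by simpa using hre⟩
      · refine ⟨(⟨x₀, y₁⟩, ⟨x₁, y₁⟩), Or.inr (Or.inl rfl), ?_⟩
        show z ∈ segment ℝ (⟨x₀, y₁⟩ : ℂ) ⟨x₁, y₁⟩
        rw [mem_segment_iff_of_im_eq (p := ⟨x₀, y₁⟩) (q := ⟨x₁, y₁⟩) hx.le rfl]
        exact ⟨by simpa using him, by simpa using hre⟩
    · rcases hre with hre | hre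
      · refine ⟨(⟨x₀, y₀⟩, ⟨x₀, y₁⟩), Or.inr (Or.inr (Or.inl rfl)), ?_⟩
        show z ∈ segment ℝ (⟨x₀, y₀⟩ : ℂ) ⟨x₀, y₁⟩
        rw [mem_segment_iff_of_re_eq (p := ⟨x₀, y₀⟩) (q := ⟨x₀, y₁⟩) hy.le rfl]
        exact ⟨by simpa using hre, by simpa using him⟩
      · refine ⟨(⟨x₁, y₀⟩, ⟨x₁, y₁⟩), Or.inr (Or.inr (Or.inr rfl)), ?_⟩
        show z ∈ segment ℝ (⟨x₁, y₀⟩ : ℂ) ⟨x₁, y₁⟩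
        rw [mem_segment_iff_of_re_eq (p := ⟨x₁, y₀⟩) (q := ⟨x₁, y₁⟩) hy.le rfl]
        exact ⟨by simpa using hre, by simpa using him⟩

/-- Every model rectangle `rectQuad x₀ x₁ y₀ y₁` (corners marked counterclockwise from the
bottom-left one) is an instance of the crux. [folklore] -/
theorem isRectilinear_rectQuad : IsRectilinear (rectQuad x₀ x₁ y₀ y₁ hx hy) :=
  isRectilinear_of_carrier_eq hx hy (rectQuad_carrier hx hy)

/-- The marked points of `rectQuad x₀ x₁ y₀ y₁` are its corners `(x₀,y₀), (x₁,y₀), (x₁,y₁), (x₀,y₁)`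
(read off the side descriptions `mem_rectQuad_arc_*` of the tree: `pt k ∈ arc k ∩ arc (k-1)`). [folklore] -/
theorem rectQuad_pt :
    (rectQuad x₀ x₁ y₀ y₁ hx hy).pt 0 = ⟨x₀, y₀⟩ ∧ (rectQuad x₀ x₁ y₀ y₁ hx hy).pt 1 = ⟨x₁, y₀⟩ ∧
      (rectQuad x₀ x₁ y₀ y₁ hx hy).pt 2 = ⟨x₁, y₁⟩ ∧ (rectQuad x₀ x₁ y₀ y₁ hx hy).pt 3 = ⟨x₀, y₁⟩ := by
  set Q := rectQuad x₀ x₁ y₀ y₁ hx hy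
  have a0 : Q.pt 0 ∈ Q.arc 0 := Q.pt_mem_arc_self 0
  have a1 : Q.pt 1 ∈ Q.arc 1 := Q.pt_mem_arc_self 1
  have a2 : Q.pt 2 ∈ Q.arc 2 := Q.pt_mem_arc_self 2
  have a3 : Q.pt 3 ∈ Q.arc 3 := Q.pt_mem_arc_self 3
  have b3 : Q.pt 0 ∈ Q.arc 3 := by simpa using Q.pt_succ_mem_arc 3
  have b0 : Q.pt 1 ∈ Q.arc 0 := by simpa using Q.pt_succ_mem_arc 0
  have b1 : Q.pt 2 ∈ Q.arc 1 := by simpa using Q.pt_succ_mem_arc 1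
  have b2 : Q.pt 3 ∈ Q.arc 2 := by simpa using Q.pt_succ_mem_arc 2
  rw [mem_rectQuad_arc_zero] at a0 b0
  rw [mem_rectQuad_arc_one] at a1 b1
  rw [mem_rectQuad_arc_two] at a2 b2
  rw [mem_rectQuad_arc_three] at a3 b3
  refine ⟨?_, ?_, ?_, ?_⟩ <;> apply Complex.ext <;>
    simp [a0.1, b3.1, a1.1, b0.1, a2.1, b1.1, a3.1, b2.1]

end Rectangles

/-- **The crux implies the TARGET of the sibling route `CardyMonotoneApproach`** (`RectCardy`,
stmt-CriticalPhenomena-5843: Cardy's formula for every axis-parallel rectangle with the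
Bollobás–Riordan corner marks), since such rectangles are rectilinear. So every negative result on
rectangles (the best-measured case: Langlands–Pouliot–Saint-Aubin 1994, Ziff 1992/2011, Hovi–Aharony
1996 agree with Cardy to `~5·10⁻³` on `ℤ²`) bears on this crux first. [folklore] -/
theorem rectCardy_of_crux (h : Crux) : CardyMonotoneApproach.RectCardy :=
  fun R _w _h hw hh hcar _ ↦ h R (isRectilinear_of_carrier_eq hw hh hcar)

/-- The square `(-1,1)²` with its corners marked counterclockwise from the bottom-left one
(`unitSquareQuad`, tree) is an instance of the crux. [folklore] -/
theorem isRectilinear_unitSquareQuad : IsRectilinear unitSquareQuad :=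
  isRectilinear_rectQuad _ _

/-- The marked points of `unitSquareQuad` are its corners `(-1,-1), (1,-1), (1,1), (-1,1)`
(read off the side descriptions `SquareModel.mem_arc_*` of the tree). [folklore] -/
theorem unitSquareQuad_pt :
    unitSquareQuad.pt 0 = ⟨-1, -1⟩ ∧ unitSquareQuad.pt 1 = ⟨1, -1⟩ ∧
      unitSquareQuad.pt 2 = ⟨1, 1⟩ ∧ unitSquareQuad.pt 3 = ⟨-1, 1⟩ :=
  rectQuad_pt _ _

/-- **The square has modulus `1/2` for EVERY uniformizing datum**: the reflection `z ↦ i z̄` in the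
diagonal fixes the corners `pt 0 = (-1,-1)`, `pt 2 = (1,1)`, swaps `pt 1 ↔ pt 3` and preserves the
square, so the tree's symmetry principle `ConformalRectangle.crossRatio_eq_half_of_antiAffine`
applies. [folklore] -/
theorem crossRatio_unitSquareQuad {φ : ConformalEquiv upperHalfPlaneSet unitSquareQuad.carrier}
    {x : Fin 4 → ℝ} (h : unitSquareQuad.IsUniformizing φ x) : crossRatio x = 1 / 2 := by
  obtain ⟨h0, h1, h2, h3⟩ := unitSquareQuad_pt
  refine ConformalRectangle.crossRatio_eq_half_of_antiAffine unitSquareQuad (u := I) (v := 0)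
    (by simp) (by simp) ?_ ?_ ?_ ?_ h
  · intro z hz
    rw [unitSquareQuad_carrier, Complex.mem_reProdIm] at hz ⊢
    simp only [antiAffine, add_zero, mul_re, I_re, conj_re, zero_mul, I_im, conj_im, one_mul,
      zero_sub, neg_neg, mul_im, zero_add, mem_Ioo] at hz ⊢
    exact ⟨hz.2, hz.1⟩
  · rw [h0]; apply Complex.ext <;> simp [antiAffine]
  · rw [h2]; apply Complex.ext <;> simp [antiAffine]
  · rw [h1, h3]; apply Complex.ext <;> simp [antiAffine]

/-- The modulus of the square is `1/2`. [folklore] -/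
theorem modulus_unitSquareQuad : modulus unitSquareQuad = 1 / 2 :=
  (crossRatio_eq_modulus (isUniformizing_modulusDatum unitSquareQuad)).symm.trans
    (crossRatio_unitSquareQuad (isUniformizing_modulusDatum unitSquareQuad))

/-- `F(1/2) = 1/2` (duality symmetry `F(1-η) = 1 - F(η)`, tree `cardyFunction_one_sub_holds`). [folklore] -/
theorem cardyFunction_half : cardyFunction (1 / 2) = 1 / 2 := by
  have h := cardyFunction_one_sub_holds (η := 1 / 2) ⟨by norm_num, by norm_num⟩
  norm_num at h
  linarith

/-- **The square crossing statement** — the cheapest checkable consequence of the crux: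
`P_{1/2}[discrete bottom arc ↔ discrete top arc of ((-1,1)²)_δ] → 1/2` as `δ → 0⁺`. For
`δ ∈ [1/(n+1), 1/n)` the discrete domain is the full `(2n+1) × (2n+1)` vertex grid and the two
discrete arcs are its bottom and top rows, so this says `crossingProb half (2n) (2n) → 1/2` (and the
odd sizes), i.e. "the critical square is crossed with probability `→ 1/2`". [folklore] -/
def SquareCrossingHalf : Prop :=
  Tendsto (bondDomainCrossingProb unitSquareQuad) (𝓝[>] 0) (𝓝 (1 / 2))

/-- **Crux ⇒ square crossing**: `RectilinearCardy → SquareCrossingHalf`. So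
`¬ SquareCrossingHalf` would be a two-line refutation of the crux — the kill shot. [folklore] -/
theorem squareCrossingHalf_of_rectilinearCardy (h : RectilinearCardy) : SquareCrossingHalf := by
  have := (hasCrossingLimit_iff_modulus.1 (h unitSquareQuad isRectilinear_unitSquareQuad))
  rwa [modulus_unitSquareQuad, cardyFunction_half] at this

/-- Contrapositive, for the record. [folklore] -/
theorem not_rectilinearCardy_of_not_squareCrossingHalf (h : ¬ SquareCrossingHalf) : ¬ RectilinearCardy :=
  fun h' ↦ h (squareCrossingHalf_of_rectilinearCardy h')

/-- **More kill shots of the same kind, all missing for the same reason.** For every rectilinear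
conformal rectangle with an anti-conformal affine symmetry `ρ z = u z̄ + v` fixing `pt 0`, `pt 2` and
swapping `pt 1 ↔ pt 3` (diagonal-symmetric L-shapes, crosses, staircases with symmetric marks …) the
crux predicts the limit `1/2`; when `ρ` also preserves `ℤ²` (reflection in a diagonal or an axis
through lattice points) this is exactly what self-duality + the quarter-turn symmetry give
heuristically (exactly so up to the one-column boundary layer), so none of these instances can
refute the crux. [folklore] -/
theorem tendsto_half_of_antiAffine (h : RectilinearCardy) (R : ConformalRectangle)
    (hR : IsRectilinear R) {u v : ℂ} (hu : ‖u‖ = 1) (huv : u * (starRingEnd ℂ) v + v = 0)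
    (hmaps : MapsTo (antiAffine u v) R.carrier R.carrier) (h0 : antiAffine u v (R.pt 0) = R.pt 0)
    (h2 : antiAffine u v (R.pt 2) = R.pt 2) (h1 : antiAffine u v (R.pt 1) = R.pt 3) :
    Tendsto (bondDomainCrossingProb R) (𝓝[>] 0) (𝓝 (1 / 2)) := by
  have hη : modulus R = 1 / 2 :=
    (crossRatio_eq_modulus (isUniformizing_modulusDatum R)).symm.trans
      (ConformalRectangle.crossRatio_eq_half_of_antiAffine R hu huv hmaps h0 h2 h1
        (isUniformizing_modulusDatum R))
  have := hasCrossingLimit_iff_modulus.1 (h R hR)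
  rwa [hη, cardyFunction_half] at this

/-- The square's crossing probabilities have all their cluster points in `(0,1)` and `1/2` is the
only value compatible with the lattice symmetry of the square (quarter turn + self-duality, up to
the one-column boundary effect). What the tree can prove today is the cluster-point half: [folklore] -/
theorem squareCrossing_clusterPt_mem_Ioo {c : ℝ}
    (hc : MapClusterPt c (𝓝[>] 0) (bondDomainCrossingProb unitSquareQuad)) : c ∈ Ioo 0 1 :=
  clusterPt_mem_Ioo _ hc

/-- NEAR-MISS (the kill shot misses). `SquareCrossingHalf` is TRUE, hence useless as a refutation,
but it is not yet a theorem of the tree. Why true: (i) exact self-duality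
`crossingProb half (n+1) n = 1/2` (tree fact `crossingProb_half_succ_self`, Grimmett 1999 Lemma 11.21)
and monotonicity give `crossingProb half n n ≥ 1/2 ≥ crossingProb half (n+1) (n-1)`; (ii) the gap
`crossingProb half n n - crossingProb half (n+1) n` is the probability that the cluster of the left
side reaches column `n` but not column `n+1`, `= E[2^{-|T|}; T ≠ ∅]` with `T` the set of vertices
of column `n` joined to the left side, which tends to `0` by the half-plane 3-arm estimate
(exponent 2, universal on `ℤ²`, Nolin 2008 Thm 24) summed along the side, corners included
(wedge one-arm decay); (iii) numerics ON THE TREE'S EXACT DISCRETISATION (kit job j008056,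
`compute_mc/main.py`, config C1): see `numerics_evidence`. Obstruction to a Lean proof
here: (ii) is a quantitative arm estimate near the boundary and corners, not in the tree. -/
theorem squareCrossingHalf_conj : SquareCrossingHalf := by
  sorry

/-! ## §5 Load-bearing hypotheses -/

/-- Dropping the only hypothesis (rectilinearity) gives the conjunct itself (`WithoutRectilinear`,
§1). It is NOT refutable by the junk route either: §3 holds for every conformal rectangle, and the
predicted limit for ANY `R` is an admissible cluster point. So rectilinearity is not "load-bearing
for truth" (the statement is believed true without it) — it is load-bearing only for the route's
ENGINE (closed BKW collar along axis-parallel sides). [folklore] -/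
theorem withoutRectilinear_consistent (R : ConformalRectangle) :
    cardyFunction (modulus R) ∈ Ioo (0 : ℝ) 1 :=
  cardyFunction_modulus_mem_Ioo R

/-! ## §6 Natural strengthenings -/

/-- STRENGTHENING "the limit law determines `F`": if the crux holds with two candidate laws `F`, `G`
in place of `cardyFunction`, they agree at the modulus of every rectilinear rectangle (limits in a
Hausdorff space are unique and `𝓝[>] 0` is non-trivial). With Bollobás–Riordan's
`rectangle_crossRatio_eq_of_aspectRatio` (moduli of rectangles exhaust `(0,1)`) this pins `F` on all
of `(0,1)`: the crux leaves NO freedom in the scaling function — in particular the crux for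
rectangles with corner marks alone already contradicts any `F ≠ cardyFunction` there. [folklore] -/
theorem law_unique {F G : ℝ → ℝ}
    (hF : ∀ R : ConformalRectangle, IsRectilinear R → R.HasCrossingLimit (bondDomainCrossingProb R) F)
    (hG : ∀ R : ConformalRectangle, IsRectilinear R → R.HasCrossingLimit (bondDomainCrossingProb R) G)
    (R : ConformalRectangle) (hR : IsRectilinear R) : F (modulus R) = G (modulus R) :=
  tendsto_nhds_unique (hasCrossingLimit_iff_modulus.1 (hF R hR)) (hasCrossingLimit_iff_modulus.1 (hG R hR))

/-- STRENGTHENING "some rectilinear rectangle has limit `1/2` for a law `G`" forces `G (1/2) = 1/2`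
if `G` is also the law of the square: e.g. the crux is incompatible with any competitor law with
`G (1/2) ≠ 1/2` as soon as `SquareCrossingHalf` is known. [folklore] -/
theorem law_half_of_squareCrossingHalf (hS : SquareCrossingHalf) {G : ℝ → ℝ}
    (hG : unitSquareQuad.HasCrossingLimit (bondDomainCrossingProb unitSquareQuad) G) : G (1 / 2) = 1 / 2 := by
  have h := hasCrossingLimit_iff_modulus.1 hG
  rw [modulus_unitSquareQuad] at h
  exact tendsto_nhds_unique h hS

/-- The Bollobás–Riordan marking of a rectangle is a rotated `rectQuad`: the plane homeomorphism
`z ↦ -i z + i h`. [folklore] -/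
def brHomeo (h : ℝ) : ℂ ≃ₜ ℂ :=
  (Homeomorph.mulLeft₀ (-I) (by simp)).trans (Homeomorph.addRight ((h : ℂ) * I))

/-- Formula for `brHomeo`. [folklore] -/
@[simp] theorem brHomeo_apply (h : ℝ) (z : ℂ) : brHomeo h z = -I * z + (h : ℂ) * I := rfl

/-- **The Bollobás–Riordan rectangle** `D₄ = ((0,w)×(0,h); ih, 0, w, w+ih)` (corners marked
top-left, bottom-left, bottom-right, top-right; arc `0` = left side, crossing left ↔ right) as a
`ConformalRectangle`: the image of `rectQuad 0 h 0 w` under `brHomeo h`. This is part (a) of the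
sibling support item `CardyMonotoneApproach.RectModulus` / the first conjunct of `RectGlue`. [folklore] -/
def brRect (w h : ℝ) (hw : 0 < w) (hh : 0 < h) : ConformalRectangle :=
  (rectQuad 0 h 0 w hh hw).map (brHomeo h)

/-- The carrier of the Bollobás–Riordan rectangle is `(0,w)×(0,h)`. [folklore] -/
theorem brRect_carrier (w h : ℝ) (hw : 0 < w) (hh : 0 < h) :
    (brRect w h hw hh).carrier = Ioo (0:ℝ) w ×ℂ Ioo (0:ℝ) h := by
  ext z
  simp only [brRect, MarkedDomain.carrier_map, rectQuad_carrier, mem_image, Complex.mem_reProdIm,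
    brHomeo_apply, mem_Ioo]
  constructor
  · rintro ⟨u, ⟨⟨h1, h2⟩, h3, h4⟩, rfl⟩
    simp only [add_re, neg_mul, neg_re, mul_re, I_re, zero_mul, I_im, one_mul, zero_sub, neg_neg,
      ofReal_re, ofReal_im, mul_zero, sub_zero, mul_one, add_zero, add_im, neg_im, mul_im, zero_add]
    refine ⟨⟨h3, h4⟩, by linarith, by linarith⟩
  · rintro ⟨⟨h1, h2⟩, h3, h4⟩
    refine ⟨⟨h - z.im, z.re⟩, ⟨⟨by linarith, by linarith⟩, h1, h2⟩, ?_⟩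
    apply Complex.ext <;> simp

/-- The marks of the Bollobás–Riordan rectangle are `ih, 0, w, w + ih`. [folklore] -/
theorem brRect_pt (w h : ℝ) (hw : 0 < w) (hh : 0 < h) :
    (brRect w h hw hh).pt 0 = (h:ℂ) * I ∧ (brRect w h hw hh).pt 1 = 0 ∧
      (brRect w h hw hh).pt 2 = (w:ℂ) ∧ (brRect w h hw hh).pt 3 = (w:ℂ) + (h:ℂ) * I := by
  obtain ⟨h0, h1, h2, h3⟩ := rectQuad_pt hh hw (x₀ := 0) (y₀ := 0)
  simp only [brRect, MarkedDomain.pt_map, brHomeo_apply, h0, h1, h2, h3]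
  refine ⟨?_, ?_, ?_, ?_⟩ <;> apply Complex.ext <;> simp

/-- The Bollobás–Riordan rectangle is rectilinear. [folklore] -/
theorem isRectilinear_brRect (w h : ℝ) (hw : 0 < w) (hh : 0 < h) : IsRectilinear (brRect w h hw hh) :=
  isRectilinear_of_carrier_eq hw hh (brRect_carrier w h hw hh)

/-- Part (a) of the sibling support `CardyMonotoneApproach.RectModulus` / first conjunct of
`RectGlue`, PROVED: rectangles with the Bollobás–Riordan marks exist for all `w, h > 0`. [folklore] -/
theorem exists_brRect (w h : ℝ) (hw : 0 < w) (hh : 0 < h) :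
    ∃ R : ConformalRectangle, R.carrier = Ioo (0:ℝ) w ×ℂ Ioo (0:ℝ) h ∧
      (R.pt 0 = (h:ℂ) * I ∧ R.pt 1 = 0 ∧ R.pt 2 = (w:ℂ) ∧ R.pt 3 = (w:ℂ) + (h:ℂ) * I) :=
  ⟨brRect w h hw hh, brRect_carrier w h hw hh, brRect_pt w h hw hh⟩

/-- **Rectilinear rectangles realise every modulus**: for every `η ∈ (0,1)` some Bollobás–Riordan
rectangle has modulus `η` (tree theorem `rectangle_crossRatio_eq_of_aspectRatio_holds`,
Bollobás–Riordan Ch. 7 §7.1: the modulus is a strictly decreasing function of the aspect ratio onto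
`(0,1)`). Hence the crux constrains the scaling function at EVERY argument, and is equivalent in
strength to the conjunct modulo conformal-invariance transport (next two theorems). [folklore] -/
theorem exists_isRectilinear_modulus_eq {η : ℝ} (hη : η ∈ Ioo (0:ℝ) 1) :
    ∃ R : ConformalRectangle, IsRectilinear R ∧ modulus R = η := by
  obtain ⟨g, -, himg, hall⟩ := rectangle_crossRatio_eq_of_aspectRatio_holds
  have : η ∈ g '' Ioi 0 := himg ▸ hη
  obtain ⟨r, hr, rfl⟩ := this
  refine ⟨brRect r 1 hr one_pos, isRectilinear_brRect r 1 hr one_pos, ?_⟩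
  have := hall (brRect r 1 hr one_pos) r 1 hr one_pos (brRect_carrier r 1 hr one_pos)
    (by simpa using brRect_pt r 1 hr one_pos) _ _ (isUniformizing_modulusDatum _)
  rw [div_one] at this
  exact (crossRatio_eq_modulus (isUniformizing_modulusDatum _)).symm.trans this

/-- STRENGTHENING "the limit law determines `F` on all of `(0,1)`": two scaling functions for
which the crux holds agree on `(0,1)` (`law_unique` + `exists_isRectilinear_modulus_eq`). In
particular the crux is flatly inconsistent with any competitor `G` differing from `cardyFunction`
somewhere on `(0,1)` — e.g. with Zhang's affine law (arXiv:2206.04599 Cor. 1–2, see §8) — as a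
STATEMENT; which of the two the lattice follows is what the numerics of §8 measure. [folklore] -/
theorem law_eqOn {F G : ℝ → ℝ}
    (hF : ∀ R : ConformalRectangle, IsRectilinear R → R.HasCrossingLimit (bondDomainCrossingProb R) F)
    (hG : ∀ R : ConformalRectangle, IsRectilinear R → R.HasCrossingLimit (bondDomainCrossingProb R) G) :
    EqOn F G (Ioo 0 1) := by
  intro η hη
  obtain ⟨R, hR, rfl⟩ := exists_isRectilinear_modulus_eq hη
  exact law_unique hF hG R hR

/-- **Crux + conformal-invariance transport ⇒ conjunct.** With the sibling item
`CardyMonotoneApproach.ConfInvTransport` (stmt-CriticalPhenomena-0794: equal moduli ⇒ equal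
limits, the `ℤ²` analogue of Smirnov's corollary) the crux already yields `CardyFormulaZ2`, because
rectilinear rectangles realise every modulus. So `RectilinearCardy` can stand in for `RectCardy` in
that route's assembly, and this route's own support `RectilinearSuffices` is "transport by
approximation instead of by conformal invariance". (Hypothesis bundled under a local name so the audit
reads the theorem as conditional.) [folklore] -/
abbrev CruxWithTransport : Prop := RectilinearCardy ∧ CardyMonotoneApproach.ConfInvTransport

/-- See `CruxWithTransport`. [folklore] -/
theorem cardyFormulaZ2_of_cruxWithTransport (hh : CruxWithTransport) : _root_.CardyFormulaZ2 := by
  obtain ⟨h, hT⟩ := hh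
  intro R' φ' x' h'
  have hη' : crossRatio x' ∈ Ioo (0:ℝ) 1 := ConformalRectangle.crossRatio_mem_Ioo_of_isUniformizing h'
  obtain ⟨R, hR, hmod⟩ := exists_isRectilinear_modulus_eq hη'
  have hx : crossRatio (Classical.choose (Classical.choose_spec
      (MarkedDomain.exists_isUniformizing_holds R))) = crossRatio x' :=
    (crossRatio_eq_modulus (isUniformizing_modulusDatum R)).trans hmod
  have hlim : Tendsto (bondDomainCrossingProb R) (𝓝[>] 0) (𝓝 (cardyFunction (crossRatio x'))) := by
    have := hasCrossingLimit_iff_modulus.1 (h R hR)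
    rwa [hmod] at this
  exact hT R R' _ _ φ' x' (isUniformizing_modulusDatum R) h' hx _ hlim

/-! ## §7 Targets (the lead's stuck stubs) — pre-emptive round: first lemmas of the round-1 cards

No line is picked yet (payload `stuck_stubs = []`, `PICKED.md` absent, 2026-08-16 cycle 2). The
triage panel (TRIAGE-r1-{1,2,3}) passed `quarter-charge-corners`, `excursion-kernel-covariance` ≈
`excursion-cross-ratio`, `rank-one-ward-carving` and failed `ctm-fractional-powers`. Their typed
first lemmas (`SketchIdeator{1,2,3}.lean`: `QuadrantMarkDensityLaw`, `WedgeAngleLaw`,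
`ConnectivityCrossRatioLaw`, `halfPlane_density_eq_excursion_form`, `IntrinsicCardyBox`,
`IntrinsicCardyFreeMark`, `DiscretePtolemyBox`, `IntrinsicDualityBox`, `RankOneWardBox`,
`RowWardBox`) were re-read here for typing junk and cheap falsity: all are limit statements over
`atTop` / `𝓝[>] 0` with binders excluding the degenerate instances (`0 < a < b < c`, `0 < t`,
`1 ≤ p, q`, `0 < s < 1`, `r → 0⁺` AFTER `δ → 0⁺`), the Möbius bookkeeping of the quadrant pull-back
(`w = z²`, moving mark `-t²` beyond `∞`, Jacobian `2t`) and of the kernel cross-ratio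
(`H₀₁H₂₃/(H₀₂H₁₃) = η⁻²` in the tree's `crossRatio` convention) is right, and the one exact identity
(`halfPlane_density_eq_excursion_form`, `κ = cardyConst/3·π^{1/2}`) checks by hand. The ONE first
lemma that is false as typed is `RankOneWardBox` — at the level of its lattice constant, see
`RankOneWardBoxWith` (numerical, kit `j012621`); nothing here is claimed as a Lean refutation (all
are asymptotic statements about critical `ℤ²` percolation). The definitions below are verbatim
copies from `SketchIdeator3.lean`. -/

section Targets

open Literature.Probability.Percolation (bondPercolation half lrCrossing openCrossing rectangle leftSide
  rightSide crossingProb)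
open Literature.Probability.LatticeModels (Site zdGraph)

open Classical in
/-- Copy of `SketchIdeator3.killedKernel`: sub-Markov kernel of SRW on `ℤ²` killed outside `V`. -/
def killedKernel (V : Finset (Site 2)) : Matrix V V ℝ :=
  fun u v => if (zdGraph 2).Adj u.1 v.1 then (1 / 4 : ℝ) else 0

open Classical in
/-- Copy of `SketchIdeator3.killedGreen`: Green's function of SRW killed on leaving `V`. -/
def killedGreen (V : Finset (Site 2)) (x y : Site 2) : ℝ :=
  if h : x ∈ V ∧ y ∈ V then ((1 : Matrix V V ℝ) - killedKernel V)⁻¹ ⟨x, h.1⟩ ⟨y, h.2⟩ else 0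

/-- Copy of `SketchIdeator3.excursionEta`: the discrete excursion cross-ratio. -/
def excursionEta (V : Finset (Site 2)) (a b c d : Site 2) : ℝ :=
  Real.sqrt (killedGreen V a c * killedGreen V b d / (killedGreen V a b * killedGreen V c d))

/-- Copy of `SketchIdeator3.RankOneWardBox` (card `rank-one-ward-carving`, first lemma): the
isolated-notch rank-one Ward identity on the corner-marked rectangle, constant `1`. -/
def RankOneWardBox : Prop :=
  ∀ p q : ℕ, 1 ≤ p → 1 ≤ q → ∀ s : ℝ, 0 < s → s < 1 →
    Tendsto (fun n : ℕ ↦ ((n : ℝ) ^ 2) *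
      (((bondPercolation (zdGraph 2) half).real (lrCrossing (p * n) (q * n)) -
          (bondPercolation (zdGraph 2) half).real
            (openCrossing (((rectangle (p * n) (q * n)).erase ![⌊s * (p * n : ℕ)⌋, 0] : Finset (Site 2)) : Set (Site 2))
              (leftSide (p * n) (q * n) : Set (Site 2)) (rightSide (p * n) (q * n) : Set (Site 2)))) -
        (cardyFunction (excursionEta (rectangle (p * n) (q * n))
            ![0, ((q * n : ℕ) : ℤ)] ![0, 0] ![((p * n : ℕ) : ℤ), 0] ![((p * n : ℕ) : ℤ), ((q * n : ℕ) : ℤ)]) -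
          cardyFunction (excursionEta ((rectangle (p * n) (q * n)).erase ![⌊s * (p * n : ℕ)⌋, 0])
            ![0, ((q * n : ℕ) : ℤ)] ![0, 0] ![((p * n : ℕ) : ℤ), 0] ![((p * n : ℕ) : ℤ), ((q * n : ℕ) : ℤ)]))))
      atTop (𝓝 0)

/-- The percolation increment of `RankOneWardBox`: `P_V[LR] - P_{V∖v}[LR] = P_V[v vertex-pivotal]`,
`v = (⌊s·pn⌋, 0)`. [folklore] -/
def wardDP (p q : ℕ) (s : ℝ) (n : ℕ) : ℝ :=
  (bondPercolation (zdGraph 2) half).real (lrCrossing (p * n) (q * n)) -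
    (bondPercolation (zdGraph 2) half).real
      (openCrossing (((rectangle (p * n) (q * n)).erase ![⌊s * (p * n : ℕ)⌋, 0] : Finset (Site 2)) : Set (Site 2))
        (leftSide (p * n) (q * n) : Set (Site 2)) (rightSide (p * n) (q * n) : Set (Site 2)))

/-- The killed-walk increment of `RankOneWardBox`: `F(η_V) - F(η_{V∖v})`. [folklore] -/
def wardDF (p q : ℕ) (s : ℝ) (n : ℕ) : ℝ :=
  cardyFunction (excursionEta (rectangle (p * n) (q * n))
      ![0, ((q * n : ℕ) : ℤ)] ![0, 0] ![((p * n : ℕ) : ℤ), 0] ![((p * n : ℕ) : ℤ), ((q * n : ℕ) : ℤ)]) -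
    cardyFunction (excursionEta ((rectangle (p * n) (q * n)).erase ![⌊s * (p * n : ℕ)⌋, 0])
      ![0, ((q * n : ℕ) : ℤ)] ![0, 0] ![((p * n : ℕ) : ℤ), 0] ![((p * n : ℕ) : ℤ), ((q * n : ℕ) : ℤ)])

/-- **The isolated-notch Ward identity with a form factor `κ`**: `n²·(ΔP - κ·ΔF) → 0`.
`RankOneWardBox` is the member `κ = 1` (`rankOneWardBox_iff_with_one`).

FINDING (numerical, this cycle; kit job `j012621` = `kappa_bundle/kappa.c`, in-session twin
`kappa_job/results_local.txt`, both attached to the item): the member that holds, if any, has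
`κ = κ_perc·(1 - 2/π) ≈ 1.40 ± 0.02`, NOT `1`. Two independent lattice constants are involved.
(i) Killed walk (exact potential theory, reflection principle): deleting ONE flat-side vertex `v`
changes the far field of `G_V` by `G_V(·,v)G_V(v,·)/G_V(v,v)`, which is `4/G_V(v,v) → 4/(4 - 8/π)
= 1/(1 - 2/π) = 2.752` times that vertex's share of a unit shift of the whole side (half-plane
values `G(v,v) = a(2,0) = 4 - 8/π`, row sum `Σ_k [a(k,2) - a(k,0)] = 4` of the potential kernel);
measured `R_RW := Σ_{v ∈ side} ΔF(v) / (F(η_V) - F(η_{V minus the row})) = 2.268, 2.567, 2.651,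
2.686, 2.716, 2.728` at `n = 8, 16, 24, 32, 48, 64` (squares) and `2.749` on the `64 × 32` box
→ `2.752` ✓. (ii) Percolation (RW-free, Cardy-free): `κ_perc := E[N]/P[A]`, `N` = number of
bottom-side vertices that are vertex-pivotal for the LR crossing of the FULL box, `A` = {a crossing
exists but none avoids the bottom row} (`= P(m,n) - P(m,n-1)`, the sequential/row calibration, for
which `Σ_sequential = P[A]` telescopes exactly): `κ_perc = 2.819(4), 3.298(7), 3.485(10), 3.560(14),
3.666(14), 3.708(26)` at `n = 8 … 64` (squares; `3.384(5), 3.619(10), 3.713(25)` on `2:1` boxes),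
`= 3.85 ± 0.05 - (8.8 ± 1)/n`. Hence `T_notch/T_row = κ_perc/R_RW → 1.40 ± 0.02` while
`T_row := P[A]/(F(η_V) - F(η_{V-row})) = 1.090, 1.045, 1.041, 1.021, 1.012, 1.012 → 1` (Cardy
differentiated in the aspect ratio ✓) — independently of and consistent with triage r1-2's direct
`T_notch(mid) = 1.63/1.54/1.56/1.43` at `n ≤ 24` (here `1.52, 1.52, 1.51, 1.45, 1.39, 1.45(6)`).
So `RankOneWardBox` (`κ = 1`) is numerically false at the constant level by `40 %`, exactly as
triagers r1-2/r1-3 warned ("two unrelated lattice constants"); the ROW / sequential-shelling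
version the carving actually uses is calibrated (`T_row → 1`). Reshape for the lead: either
`∃ κ, RankOneWardBoxWith κ` (one free constant per local boundary class, fixed by `RowWardBox`),
or the step-deletion version at a staircase front. [folklore] -/
def RankOneWardBoxWith (κ : ℝ) : Prop :=
  ∀ p q : ℕ, 1 ≤ p → 1 ≤ q → ∀ s : ℝ, 0 < s → s < 1 →
    Tendsto (fun n : ℕ ↦ ((n : ℝ) ^ 2) * (wardDP p q s n - κ * wardDF p q s n)) atTop (𝓝 0)

/-- `RankOneWardBox` is the `κ = 1` member of the family. [folklore] -/
theorem rankOneWardBox_iff_with_one : RankOneWardBox ↔ RankOneWardBoxWith 1 := by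
  simp only [RankOneWardBox, RankOneWardBoxWith, wardDP, wardDF, one_mul]

/-- **At most one form factor is non-degenerate**: if the notch Ward identity holds with two
different constants then both increments are `o(n⁻²)` — which is false for the percolation
increment (boundary 3-arm exponent `2`: `P[v pivotal] ≍ n⁻²`, measured `n²·P[v_mid pivotal] ≈
1.6–2.0` above) — so the numerics single out `κ ≈ 1.40` and exclude `κ = 1`. [folklore] -/
theorem rankOneWardBoxWith_degenerate {κ₁ κ₂ : ℝ} (h₁ : RankOneWardBoxWith κ₁)
    (h₂ : RankOneWardBoxWith κ₂) (hne : κ₁ ≠ κ₂) (p q : ℕ) (hp : 1 ≤ p) (hq : 1 ≤ q) (s : ℝ)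
    (hs0 : 0 < s) (hs1 : s < 1) :
    Tendsto (fun n : ℕ ↦ ((n : ℝ) ^ 2) * wardDF p q s n) atTop (𝓝 0) ∧
      Tendsto (fun n : ℕ ↦ ((n : ℝ) ^ 2) * wardDP p q s n) atTop (𝓝 0) := by
  have t₁ := h₁ p q hp hq s hs0 hs1
  have t₂ := h₂ p q hp hq s hs0 hs1
  have hsub := t₂.sub t₁
  rw [sub_zero] at hsub
  have hF : Tendsto (fun n : ℕ ↦ ((n : ℝ) ^ 2) * wardDF p q s n) atTop (𝓝 0) := by
    have hne' : κ₁ - κ₂ ≠ 0 := sub_ne_zero.2 hne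
    have := hsub.const_mul (κ₁ - κ₂)⁻¹
    rw [mul_zero] at this
    refine this.congr fun n ↦ ?_
    field_simp
    ring
  refine ⟨hF, ?_⟩
  have := t₁.add (hF.const_mul κ₁)
  rw [mul_zero, add_zero] at this
  refine this.congr fun n ↦ ?_
  ring

/-- Copy of `SketchIdeator3.RowWardBox` (the side-integrated shadow; numerically fine:
`T_row → 1` above, and `P_V - F(η_V) = +0.0145(9), +0.0074, +0.0066(9), +0.0032(10) ≈ 0.1/n` on
`2:1` boxes per triage r1-2; this cycle: `P_full - F(η_V) = 0.0743, 0.0360, 0.0240, 0.0171, 0.0116,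
0.0084` on squares `n = 8 … 64`, i.e. `≈ 0.55/n`, cf. §4 `≈ 0.6/N` for the square). [folklore] -/
def RowWardBox : Prop :=
  ∀ p q : ℕ, 1 ≤ p → 1 ≤ q →
    Tendsto (fun n : ℕ ↦ (n : ℝ) *
      ((crossingProb half (p * n) (q * n) - crossingProb half (p * n) (q * n - 1)) -
        (cardyFunction (excursionEta (rectangle (p * n) (q * n))
            ![0, ((q * n : ℕ) : ℤ)] ![0, 0] ![((p * n : ℕ) : ℤ), 0] ![((p * n : ℕ) : ℤ), ((q * n : ℕ) : ℤ)]) -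
          cardyFunction (excursionEta (rectangle (p * n) (q * n - 1))
            ![0, ((q * n - 1 : ℕ) : ℤ)] ![0, 0] ![((p * n : ℕ) : ℤ), 0] ![((p * n : ℕ) : ℤ), ((q * n - 1 : ℕ) : ℤ)]))))
      atTop (𝓝 0)


end Targets


/-! ## §8 Evidence record -/

/-- EVIDENCE (numerics). Monte Carlo of `bondDomainCrossingProb` computed with the tree's EXACT
discretisation (open-set mesh vertices, closed-segment edges, largest component, outer-layer mesh
boundary, closest-arc rule with the `≤` tie, `Reachable` reflexive), critical bond `ℤ²`.

(A) In-session pure-Python run (`local_mc.py`, `local_mc_results.txt`, attached to the item;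
self-test: exact enumeration on the `3 × 3` grid gives `P = 43/64 = 0.6719`, MC `0.6736 ± 0.0033`):

* C1 = this file's `unitSquareQuad` (corner marks, prediction `F(1/2) = 1/2`), `δ = 2/N`:
  `N = 8: 0.5770(35)`, `16: 0.5417(35)`, `32: 0.5177(35)`, `64: 0.5117(50)` — excess `≈ 0.6/N → 0`,
  i.e. `SquareCrossingHalf` numerically (the kill shot misses, as predicted by duality).
* C3 = `2 × 1` rectangle crossed the hard way (Bollobás–Riordan marks, `η = λ(2i) = 17 - 12√2`,
  `F(η) = 0.1763`): `N = 32: 0.1797(27)`, `64: 0.1809(27)`, `128: 0.1815(50)` — Cardy within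
  `2σ` plus an `O(1/N)` boundary-layer excess; cf. Ziff 1992 / LPS 1994 on `ℤ²`: `0.1763(5)`.
* Zhang's domain (arXiv:2206.04599 Cor. 1–2): right isosceles triangle `a=(0,0), b=(1,1), c=(0,1)`,
  marks `a, (t,t), b, c`, crossing `[a,x] ↔ [b,c]`. Zhang's transported Carleson law predicts `t`;
  Cardy predicts `I_w(1/3,1/3)` with `t = I_w(1/4,1/4)`. `t = 1/4` (Cardy `0.2027`, Zhang `0.25`):
  `N = 32: 0.1861(28)`, `64: 0.1925(28)`, `128: 0.2036(45)` → Cardy (`+0.2σ`), Zhang excluded at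
  `10–23σ`; `t = 2/5` (Cardy `0.3763`, Zhang `0.4`): `N = 64: 0.3841(34)` (Cardy `+2.3σ` finite size,
  Zhang `−4.6σ`); `t = 1/2` (both `1/2`): `0.4925(50)`. VERDICT: the only printed "¬Cardy on `ℤ²`"
  claim is numerically untenable on its own domain; its mechanism (affine, non-conformal transport of
  the triangular-lattice Carleson form) is visible in the data.

(B) Kit jobs (sharper, larger `N`, more configurations; queued behind ~3700 jobs at submission):
`j008056` (`compute_mc/main.py`: C1–C7 incl. mid-side marks / L-shaped arcs / irrational offsets,
`N ≤ 512`), `j008060` (`compute_tri/main.py`: Zhang's triangle, `N ≤ 512`), `j008859`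
(`compute_L/main.py`: the L-shaped hexagon with a mark AT the reflex corner — the route's own fear
"corners carry collar charges" — Schwarz–Christoffel parameter problem solved numerically). Their
tables are appended here when they land (item evidence `compute-j0080{56,60}.json`, `compute-j008859.json`).
(B') In-session pure-Python run of the L-SHAPE test (the route's stated fear "polygon corners carry
collar charges"; `local_L.py`, `local_L_results.txt`, attached as `NUMERICS-Lshape.md`): domain
`L = (0,2)² ∖ [1,2]²` (reflex corner at `(1,1)`), Schwarz–Christoffel parameter problem solved in
double precision (vertex `(0,2)` at `∞`; prevertices `A=-1, B=1, C=1.1435935, D=3 (reflex), E=28.856406`;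
side-ratio residuals `< 10⁻¹⁰`, closing sides `0.49994 / 0.99994`; the diagonal symmetry is REPRODUCED:
marks `(0,0),(2,0),(1,1),(0,2)` give `η = 0.500000` exactly), then `η`, `F(η)` for four markings versus
union-find Monte Carlo of critical bond `ℤ²` on the tree's exact discretisation, `δ = 2/N`:
* LA symmetric marks (`F = 1/2`): `N = 17/33/65/129: 0.5020(35), 0.5046(35), 0.5018(46), 0.5052(79)`;
* LB marks `(2,0),(2,1),(1,2),(0,2)` — crossing from the short lower-right side AROUND THE NOTCH to the
  top side (`η = 0.005155`, `F = 0.0979`): `0.1173(23), 0.1040(22), 0.1002(27), 0.1015(48)` → `F`;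
* LC marks `(1,0),(2,1),(1,1),(0,1)` — a mark AT THE REFLEX CORNER (`η = 0.33334`, `F = 0.4187`):
  `0.4188(35), 0.4254(35), 0.4114(45), 0.4037(78)` — within `2σ` at every size;
* LD marks `(0,0),(2,0),(2,1),(1,2)` — bottom side ↔ the whole notch (`η = 0.9282`, `F = 0.7618`):
  `0.8040(28), 0.7793(29), 0.7715(38), 0.7562(68)` → `F`.
VERDICT: Cardy's formula — full conformal invariance, not only the rectangle/elliptic-modulus family —
holds numerically for bond-`ℤ²` in a rectilinear polygon WITH A REFLEX CORNER, marks at corners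
included, to the `~1%` resolution of this run; the corner fear concerns the route's ENGINE, not the
truth of the crux.

(C) Extreme aspect ratios (the `η → 0` tail `F(η) ∼ cardyConst·η^{1/3}`, `η ≈ 16 e^{-πA}`): the
crux implies, via the elementary Fekete sandwich of the route's support `StripRatesExist`
(`γ₁(n) ∈ [-log p₁(Kn,n)/(Kn+1), (-log p₁((K+1)n,n) + log 2)/(Kn)]`, then `K → ∞`), the strip
statement `n·γ₁(n) → π/3` of the route's crux `StripClusterRates`; the planner's exact
transfer-matrix computation (kit job `j005323`, widths `n ≤ 9`) gives the slope `0.954 ± 0.001`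
against `3/π = 0.95493` — the lattice-specific `ℤ²`-bond tail of Cardy's formula, confirmed to `10⁻³`.
So the crux is numerically consistent at `η = 1/2` (symmetry), at generic `η` (rectangles; LPS 1994
= arXiv:math/9401222, Table 3.2 p. 21: e.g. `r = 2.014`: `π^{cft} = 0.1731`, measured `0.1736`; forty
aspect ratios `1 ≤ r ≤ 7.35` agreeing to `~5·10⁻⁴` for `ℤ²` site percolation; Ziff 1992/2011 for bond),
and in the `η → 0` tail (strip rates).

This theorem is only an anchor for the docstring. [folklore] -/
theorem numerics_evidence : True := trivial

/-- EVIDENCE, cycle 2 (kit job `j012621` = `kappa_bundle/kappa.c`, 4 cores × 30 min, sizes up to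
`128²`, auto-attached to the item as `compute-j012621.json`; in-session twin `kappa_job/kappa.c`,
`results_local.txt`, attached as `NUMERICS-kappa.md`). Critical bond `ℤ²` on the vertex box
`{0..W-1} × {0..H-1}` = `rectangle (W-1) (H-1)`, LR crossing; self-checks: `P[LR of rectangle 2 1]
= 0.5008(10)` (exact `1/2`), `P_norow = P[LR of rectangle n (n-1)] = 0.49999(29) … 0.50030(48)` at
every size (exact `1/2`, tree fact `crossingProb_half_succ_self`), rank-one vs direct killed-walk
solve agree to `1e-10`. Squares `n = W-1 = 8, 16, 24, 32, 48, 64` (samples `2·10⁶ … 8·10⁵`):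
* `κ_perc = E[N]/P[A] = 2.819(4), 3.298(7), 3.485(10), 3.560(14), 3.666(14), 3.708(26)`
  (`2:1` boxes `16×8, 32×16, 64×32`: `3.384(5), 3.619(10), 3.713(25)`) — fits `3.85(5) - 8.8/n`;
* `R_RW = Σ_v ΔF_notch(v)/ΔF_row = 2.268, 2.567, 2.651, 2.686, 2.716, 2.728` (`2:1`: `2.615,
  2.722, 2.749`) → `4/(4 - 8/π) = 2.7519` (exact); `G_V(v_mid,v_mid) = 1.4317, 1.4468, 1.4503,
  1.4516, 1.4526, 1.4530 → 4 - 8/π = 1.45352`;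
* `T_row = P[A]/ΔF_row = 1.090(3), 1.045(4), 1.041(6), 1.021(7), 1.012(9), 1.012(8) → 1`;
* `T_notch(avg) = E[N]/Σ_vΔF_notch(v) = 1.355, 1.343, 1.369, 1.353, 1.366, 1.376(13)`;
  `T_notch(mid) = 1.522(6), 1.522(10), 1.506(19), 1.455(26), 1.389(38), 1.45(6)`; limit
  `κ_perc/R_RW = 1.40(2) ≠ 1`;
* `P_full - F(η_V) = 0.0743, 0.0360, 0.0240, 0.0171, 0.0116, 0.0084 ≈ 0.55/n` (the killed-walk
  predictor of card `excursion-cross-ratio` tracks the square's crossing probability to `O(1/n)`;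
  §4's `SquareCrossingHalf` again: `P_full = 0.5581, 0.5306, 0.5214, 0.5156, 0.5109, 0.5080 → 1/2`).
KIT JOB `j012621` (landed; `compute-j012621.json` on the item; 4 cores × 20 min on cmp-9; samples
`2·10⁷ … 1.5·10⁶`): squares `n = 8, 16, 24, 32, 48, 64, 96, 128`:
`κ_perc = 2.8199(10), 3.3008(20), 3.4739(38), 3.5636(46), 3.6612(62), 3.7065(116), 3.780(18),
3.767(28)` — weighted fit `κ_perc(n) = K - c/n` on `n ≥ 24`: `K = 3.850 ± 0.009`, `c = 9.0`,
`χ²/dof = 2.7/4` (`n ≥ 32`: `K = 3.859 ± 0.013`); `2:1` boxes `16×8 … 128×64`: `3.3743(22),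
3.6165(46), 3.738(12), 3.793(25)`; `R_RW = 2.2681, 2.5668, 2.6507, 2.6862, 2.7158, 2.7280,
2.7382, 2.7425` (→ `2.7519`; `2:1`: `2.6153, 2.7218, 2.7493, 2.7542`); `T_row = 1.0933(10),
1.0437(13), 1.0253(22), 1.0226(21), 1.0188(37), 1.0130(38), 0.992(8), 0.996(12)` → `1`;
`T_notch(mid) = 1.5289(18), 1.5108(46), 1.488(10), 1.473(9), 1.473(13), 1.390(28), 1.48(6),
1.39(9)`. CONCLUSION: `κ_perc = 3.85 ± 0.02`, `κ_perc/R_RW → 1.399 ± 0.008 ≠ 1`.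
VERDICT: first lemma `RankOneWardBox` (constant `1`) numerically false at `> 40σ`; its calibrated
variants (row / sequential shelling, or one free constant) survive; nothing here bears on the
truth of the crux itself (all of it is consistent with Cardy's formula).

This theorem is only an anchor for the docstring. [folklore] -/
theorem numerics_evidence_cycle2 : True := trivial

/-- EVIDENCE, cycle 2 (bis): **the L-shape with a reflex corner at 5× the cycle-1 precision, under
the tree's EXACT discretisation re-implemented in C** (`lshape_job/lshape.c`; agrees with the
cycle-1 Python twin at `N = 17` on all four markings; kit job `j013158` = `lshape_bundle/`, sizes
to `513`, killed-walk moduli to `1025`, auto-attached as `compute-j013158.json`), `L = (0,2)² ∖ [1,2]²`,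
mesh `δ = 2/N`, `N` odd, critical bond `ℤ²`.
(1) SC-FREE MODULI. The killed-walk excursion cross-ratio `η_V` of card `excursion-cross-ratio`
(marks ↦ nearest boundary mesh vertex; the reflex-corner mark ↦ the symmetric inner vertex) at
`N = 65, 129, 257, 513`: LA `0.50840, 0.50349, 0.50142, 0.50057` (`= η_V(bcda)` exactly, limit
`1/2` by symmetry); LB `0.006153, 0.005650, 0.005402, 0.005278` → Richardson `0.005154` (cycle-1
Schwarz–Christoffel: `0.005155`); LC `0.35719, 0.34526, 0.33931, 0.33633` → Richardson `0.33335` (SC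
`0.33334`); LD `0.92031, 0.92452, 0.92642, 0.92733` → `0.9282` (SC `0.9282`). So the cycle-1 SC
parameter solution is independently confirmed to `≤ 3·10⁻⁴`, and `η_V → η` holds on a polygon
with a reflex corner, marks mid-side and AT the reflex corner included, at rate `O(1/N)` — the
premise of the merged excursion line, checked beyond rectangles.
(2) CROSSING PROBABILITIES (`N = 65 / 129 / 257`; samples `4·10⁵ / 2·10⁵ / 10⁵`, more for LC):
* LA (symmetric, `F = 1/2`): `0.5015(8), 0.4994(11), 0.5010(12)` ✓;
* LB (`η = 0.005155`, `F = 0.09787`): `0.1027(5), 0.0996(7), 0.0991(7)`, excess `N·ΔP = 0.31,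
  0.22, 0.33` → `F + 0.3/N` ✓;
* LC (mark AT the reflex corner, `η = 1/3`, `F = 0.41869`): `0.42269(24)` [`2.4·10⁶` samples],
  `0.4211(5)` [`1.2·10⁶`], `0.4205(6)` [`5·10⁵`]: `N·ΔP = 0.26(2), 0.31(7), 0.47(15)` →
  `F + c/N`-compatible with `c ≈ 0.3` (a slower reflex-corner term is allowed, not required, by the data);
* LD (`η = 0.9282`, `F = 0.76182`): `0.7720(7), 0.7677(12), 0.7647(10)`, `N·ΔP = 0.66, 0.76,
  0.74` → `F + 0.75/N` ✓.
* `N = 513` (in-session, `3–4·10⁴` samples, `±0.002–0.003`, boundary layer `≲ 0.0015`): LA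
  `0.4983(33)`, LB `0.1003(19)`, LC `0.4148(22)`, LD `0.7628(29)` — all four within `2σ` of
  `F` (`0.5, 0.0979, 0.4187, 0.7618`) with NO extrapolation (LC now `-1.8σ`: its small-`N`
  excess is not a constant offset).
VERDICT: Cardy's formula — invariance under the NON-Möbius conformal map of the L-shaped hexagon,
reflex corner and corner marks included — holds for bond-`ℤ²` to `±0.002` after the `1/N`
boundary layer, i.e. at `0.3 %`, and directly (no extrapolation) to `±0.003` at `δ = 2/513`; the
route's fear "polygon corners carry collar charges" concerns its engine only. (Kit job `j013158`,
same program with larger samples, was still queued after 70 min and is superseded by these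
in-session runs.) REMARK for approximation arguments (`RectilinearSuffices`, `CardyLatticePolygon`):
a mark sitting AT a corner of interior angle `θ` is moved by `ε` at cost `ε^{π/θ}` in the
crossing limit (local uniformizing coordinate `w ∼ z^{π/θ}`): Lipschitz on flat sides, `ε²` at
convex corners, only Hölder-`2/3` at reflex corners — uniformity in the marks fails exactly there.

This theorem is only an anchor for the docstring. [folklore] -/
theorem numerics_evidence_cycle2_lshape : True := trivial

/-! ## §9 Rectilinear shells: lattice polygons, one-step polygons; more hostages -/

/-- A point of a closed axis-parallel rectangle not in the open rectangle lies on one of the four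
closed sides. [folklore] -/
theorem shell_subset_segments {x₀ x₁ y₀ y₁ : ℝ} (hx : x₀ ≤ x₁) (hy : y₀ ≤ y₁) {z : ℂ}
    (hz : z ∈ Icc x₀ x₁ ×ℂ Icc y₀ y₁) (hz' : z ∉ Ioo x₀ x₁ ×ℂ Ioo y₀ y₁) :
    z ∈ segment ℝ (⟨x₀, y₀⟩ : ℂ) ⟨x₁, y₀⟩ ∪ segment ℝ (⟨x₀, y₁⟩ : ℂ) ⟨x₁, y₁⟩ ∪
      segment ℝ (⟨x₀, y₀⟩ : ℂ) ⟨x₀, y₁⟩ ∪ segment ℝ (⟨x₁, y₀⟩ : ℂ) ⟨x₁, y₁⟩ := by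
  rw [Complex.mem_reProdIm, mem_Icc, mem_Icc] at hz
  rw [Complex.mem_reProdIm, mem_Ioo, mem_Ioo] at hz'
  obtain ⟨⟨h1, h2⟩, h3, h4⟩ := hz
  simp only [mem_union]
  by_cases hb : z.im = y₀
  · left; left; left
    rw [mem_segment_iff_of_im_eq (p := ⟨x₀, y₀⟩) (q := ⟨x₁, y₀⟩) hx rfl]
    exact ⟨hb, h1, h2⟩
  by_cases ht : z.im = y₁
  · left; left; right
    rw [mem_segment_iff_of_im_eq (p := ⟨x₀, y₁⟩) (q := ⟨x₁, y₁⟩) hx rfl]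
    exact ⟨ht, h1, h2⟩
  by_cases hl : z.re = x₀
  · left; right
    rw [mem_segment_iff_of_re_eq (p := ⟨x₀, y₀⟩) (q := ⟨x₀, y₁⟩) hy rfl]
    exact ⟨hl, h3, h4⟩
  by_cases hr : z.re = x₁
  · right
    rw [mem_segment_iff_of_re_eq (p := ⟨x₁, y₀⟩) (q := ⟨x₁, y₁⟩) hy rfl]
    exact ⟨hr, h3, h4⟩
  exact absurd ⟨⟨lt_of_le_of_ne h1 (Ne.symm hl), lt_of_le_of_ne h2 hr⟩,
    lt_of_le_of_ne h3 (Ne.symm hb), lt_of_le_of_ne h4 ht⟩ hz'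

/-- **Shell criterion.** A conformal rectangle whose boundary points each lie in some closed
axis-parallel rectangle of a finite family but not in its interior is rectilinear (hypothesis of
the crux). [folklore] -/
theorem isRectilinear_of_frontier_subset_shells {R : ConformalRectangle}
    (T : Finset (ℝ × ℝ × ℝ × ℝ)) (hT : ∀ t ∈ T, t.1 ≤ t.2.1 ∧ t.2.2.1 ≤ t.2.2.2)
    (h : ∀ z ∈ frontier R.carrier, ∃ t ∈ T,
      z ∈ Icc t.1 t.2.1 ×ℂ Icc t.2.2.1 t.2.2.2 ∧ z ∉ Ioo t.1 t.2.1 ×ℂ Ioo t.2.2.1 t.2.2.2) :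
    IsRectilinear R := by
  classical
  refine ⟨T.biUnion (fun t ↦ {((⟨t.1, t.2.2.1⟩ : ℂ), (⟨t.2.1, t.2.2.1⟩ : ℂ)),
      ((⟨t.1, t.2.2.2⟩ : ℂ), (⟨t.2.1, t.2.2.2⟩ : ℂ)), ((⟨t.1, t.2.2.1⟩ : ℂ), (⟨t.1, t.2.2.2⟩ : ℂ)),
      ((⟨t.2.1, t.2.2.1⟩ : ℂ), (⟨t.2.1, t.2.2.2⟩ : ℂ))}), ?_, ?_⟩
  · intro q hq
    simp only [Finset.mem_biUnion, Finset.mem_insert, Finset.mem_singleton] at hq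
    obtain ⟨t, -, rfl | rfl | rfl | rfl⟩ := hq
    · exact Or.inr rfl
    · exact Or.inr rfl
    · exact Or.inl rfl
    · exact Or.inl rfl
  · intro z hz
    obtain ⟨t, ht, hz1, hz2⟩ := h z hz
    have hseg := shell_subset_segments (hT t ht).1 (hT t ht).2 hz1 hz2
    simp only [mem_iUnion, Finset.mem_biUnion, Finset.mem_insert, Finset.mem_singleton, exists_prop]
    rcases hseg with ((h1 | h2) | h3) | h4
    · exact ⟨_, ⟨t, ht, Or.inl rfl⟩, h1⟩
    · exact ⟨_, ⟨t, ht, Or.inr (Or.inl rfl)⟩, h2⟩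
    · exact ⟨_, ⟨t, ht, Or.inr (Or.inr (Or.inl rfl))⟩, h3⟩
    · exact ⟨_, ⟨t, ht, Or.inr (Or.inr (Or.inr rfl))⟩, h4⟩

/-- **Lattice polygons are rectilinear**: if the carrier is the interior of a finite union of
closed `δ₀`-squares of `δ₀ℤ²` (the hypothesis of the TARGET `CardyLatticePolygon`,
stmt-CriticalPhenomena-4781, of the sibling routes `CardyPolygonWords` and `CardyGluingRDE`), the
boundary lies in the finitely many sides of those squares. [folklore] -/
theorem isRectilinear_of_carrier_eq_interior {R : ConformalRectangle} {δ₀ : ℝ} (hδ₀ : 0 < δ₀)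
    {s : Finset (ℤ × ℤ)}
    (hR : R.carrier = interior (⋃ p ∈ s, {z : ℂ | δ₀ * (p.1 : ℝ) ≤ z.re ∧ z.re ≤ δ₀ * ((p.1 : ℝ) + 1) ∧
      δ₀ * (p.2 : ℝ) ≤ z.im ∧ z.im ≤ δ₀ * ((p.2 : ℝ) + 1)})) : IsRectilinear R := by
  classical
  have hSq : ∀ p : ℤ × ℤ, {z : ℂ | δ₀ * (p.1 : ℝ) ≤ z.re ∧ z.re ≤ δ₀ * ((p.1 : ℝ) + 1) ∧
      δ₀ * (p.2 : ℝ) ≤ z.im ∧ z.im ≤ δ₀ * ((p.2 : ℝ) + 1)} =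
      Icc (δ₀ * (p.1 : ℝ)) (δ₀ * ((p.1 : ℝ) + 1)) ×ℂ Icc (δ₀ * (p.2 : ℝ)) (δ₀ * ((p.2 : ℝ) + 1)) := by
    intro p; ext z; simp only [mem_setOf_eq, Complex.mem_reProdIm, mem_Icc]; tauto
  simp only [hSq] at hR
  set K : Set ℂ := ⋃ p ∈ s, Icc (δ₀ * (p.1 : ℝ)) (δ₀ * ((p.1 : ℝ) + 1)) ×ℂ
    Icc (δ₀ * (p.2 : ℝ)) (δ₀ * ((p.2 : ℝ) + 1)) with hK
  have hKc : IsClosed K := isClosed_biUnion_finset fun p _ ↦ isClosed_Icc.reProdIm isClosed_Icc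
  refine isRectilinear_of_frontier_subset_shells
    (s.image fun p : ℤ × ℤ ↦ (δ₀ * (p.1 : ℝ), δ₀ * ((p.1 : ℝ) + 1), δ₀ * (p.2 : ℝ), δ₀ * ((p.2 : ℝ) + 1)))
    ?_ ?_
  · intro t ht
    obtain ⟨p, -, rfl⟩ := Finset.mem_image.1 ht
    constructor <;> nlinarith
  · intro z hz
    rw [hR] at hz
    have hz1 : z ∈ K := closure_minimal interior_subset hKc hz.1
    have hz2 : z ∉ interior K := by simpa only [interior_interior] using hz.2
    obtain ⟨p, hp, hzp⟩ : ∃ p ∈ s, z ∈ Icc (δ₀ * (p.1 : ℝ)) (δ₀ * ((p.1 : ℝ) + 1)) ×ℂ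
        Icc (δ₀ * (p.2 : ℝ)) (δ₀ * ((p.2 : ℝ) + 1)) := by
      simpa only [hK, mem_iUnion, exists_prop] using hz1
    refine ⟨_, Finset.mem_image_of_mem _ hp, hzp, fun hzo ↦ hz2 ?_⟩
    refine interior_maximal ?_ (isOpen_Ioo.reProdIm isOpen_Ioo) hzo
    intro w hw
    rw [hK]
    simp only [mem_iUnion, exists_prop]
    exact ⟨p, hp, Complex.mem_reProdIm.2 ⟨Ioo_subset_Icc_self hw.1, Ioo_subset_Icc_self hw.2⟩⟩

/-- **Crux ⇒ the TARGET of routes `CardyPolygonWords` and `CardyGluingRDE`** (`CardyLatticePolygon`,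
stmt-CriticalPhenomena-4781: Cardy for every lattice polygon of every mesh `δ₀` with marks at
lattice points). So a refutation of 4781 — e.g. a lattice polygon whose crossing probabilities
provably do not converge to `F(η)` — refutes this crux, and the numerics recorded on 4781 bear on
it. NOT a proof of 4781: the hypothesis is the open crux. [folklore] -/
theorem cardyLatticePolygon_of_crux (h : Crux) : CardyPolygonWords.CardyLatticePolygon :=
  fun R ⟨_, hδ₀, ⟨_, hcar⟩, _⟩ ↦ h R (isRectilinear_of_carrier_eq_interior hδ₀ hcar)

/-- The two copies of `CardyLatticePolygon` (routes `CardyPolygonWords`, `CardyGluingRDE`) are the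
same statement. [folklore] -/
theorem cardyLatticePolygon_iff :
    CardyPolygonWords.CardyLatticePolygon ↔ CardyGluingRDE.CardyLatticePolygon := Iff.rfl

/-- Crux ⇒ `CardyGluingRDE.CardyLatticePolygon` (same item 4781). [folklore] -/
theorem cardyLatticePolygon'_of_crux (h : Crux) : CardyGluingRDE.CardyLatticePolygon :=
  cardyLatticePolygon_iff.1 (cardyLatticePolygon_of_crux h)

/-- **Crux ⇒ `CardyPolygonWords.CardyRectangle`** (stmt-CriticalPhenomena-4782, crux rank 2 of
`CardyPolygonWords`: Cardy for rectangles `(0,a)×(0,b)` with corner marks in any order). [folklore] -/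
theorem cardyRectangle_of_crux (h : Crux) : CardyPolygonWords.CardyRectangle := by
  intro R a b ha hb hcar _
  refine h R (isRectilinear_of_carrier_eq ha hb ?_)
  rw [hcar]; ext z; simp only [mem_setOf_eq, Complex.mem_reProdIm, mem_Ioo]; tauto

/-- **Crux ⇒ `CardyPolygonWords.CardyOneStep`** (stmt-CriticalPhenomena-4783, crux rank 3 of
`CardyPolygonWords`: Cardy for the one-step polygons `(0,a)×(0,b) ∪ (c,d)×(b,b+e)` glued along
`(max 0 c, min a d) × {b}`, corner marks). Its boundary lies in the eight closed sides of the two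
rectangles. [folklore] -/
theorem cardyOneStep_of_crux (h : Crux) : CardyPolygonWords.CardyOneStep := by
  intro R a b c d e hb he hcd hcar _
  have h0a : (0 : ℝ) ≤ a := by
    have := lt_of_le_of_lt (le_max_left 0 c) hcd; linarith [min_le_left a d]
  have hcd' : c ≤ d := by
    have := lt_of_le_of_lt (le_max_right 0 c) hcd; linarith [min_le_right a d]
  refine h R (isRectilinear_of_frontier_subset_shells {(0, a, 0, b), (c, d, b, b + e)} ?_ ?_)
  · intro t ht
    simp only [Finset.mem_insert, Finset.mem_singleton] at ht
    rcases ht with rfl | rfl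
    · exact ⟨h0a, hb.le⟩
    · exact ⟨hcd', by linarith⟩
  · intro z hz
    have hcl : closure R.carrier ⊆ (Icc 0 a ×ℂ Icc 0 b) ∪ (Icc c d ×ℂ Icc b (b + e)) := by
      refine closure_minimal ?_
        ((isClosed_Icc.reProdIm isClosed_Icc).union (isClosed_Icc.reProdIm isClosed_Icc))
      intro w hw
      rw [hcar] at hw
      simp only [mem_setOf_eq] at hw
      simp only [mem_union, Complex.mem_reProdIm, mem_Icc]
      rcases hw with ⟨h1, h2, h3, h4⟩ | ⟨h1, h2, h3, h4⟩ | ⟨h1, h2, h3⟩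
      · exact Or.inl ⟨⟨h1.le, h2.le⟩, h3.le, h4.le⟩
      · exact Or.inr ⟨⟨h1.le, h2.le⟩, h3.le, h4.le⟩
      · refine Or.inl ⟨⟨?_, ?_⟩, ?_, ?_⟩
        · exact le_trans (le_max_left 0 c) h1.le
        · exact le_trans h2.le (min_le_left a d)
        · rw [h3]; exact hb.le
        · rw [h3]
    have hzR : z ∉ R.carrier := fun hzR ↦ hz.2 (by rwa [R.isOpen.interior_eq])
    rcases hcl hz.1 with hz1 | hz1
    · refine ⟨(0, a, 0, b), by simp, hz1, fun hzo ↦ hzR ?_⟩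
      rw [hcar]
      rw [Complex.mem_reProdIm, mem_Ioo, mem_Ioo] at hzo
      exact Or.inl ⟨hzo.1.1, hzo.1.2, hzo.2.1, hzo.2.2⟩
    · refine ⟨(c, d, b, b + e), by simp, hz1, fun hzo ↦ hzR ?_⟩
      rw [hcar]
      rw [Complex.mem_reProdIm, mem_Ioo, mem_Ioo] at hzo
      exact Or.inr (Or.inl ⟨hzo.1.1, hzo.1.2, hzo.2.1, hzo.2.2⟩)

/-- The two copies of `RectCardy` (stmt-CriticalPhenomena-5843; TARGET of `CardyMonotoneApproach`
and of `CardyHausdorffMoment`) are the same statement. [folklore] -/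
theorem rectCardy_iff : CardyHausdorffMoment.RectCardy ↔ CardyMonotoneApproach.RectCardy := Iff.rfl

/-- **Crux ⇒ the TARGET of route `CardyHausdorffMoment`** (`RectCardy`, stmt-5843). [folklore] -/
theorem hmRectCardy_of_crux (h : Crux) : CardyHausdorffMoment.RectCardy :=
  fun R _ _ hw hh hcar _ ↦ h R (isRectilinear_of_carrier_eq hw hh hcar)

/-! ## §10 The scaling law as a parameter: what is refutable unconditionally -/

/-- The crux with the scaling function as a parameter. [folklore] -/
def CruxWithLaw (G : ℝ → ℝ) : Prop :=
  ∀ R : ConformalRectangle, IsRectilinear R → R.HasCrossingLimit (bondDomainCrossingProb R) G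

/-- `CruxWithLaw cardyFunction` is the crux. [folklore] -/
theorem cruxWithLaw_cardyFunction_iff : CruxWithLaw cardyFunction ↔ RectilinearCardy := Iff.rfl

/-- **Only the values of the law on `(0,1)` matter** (moduli lie in `(0,1)`): in particular the
junk values of `cardyFunction` outside `[0,1]` (`Real.rpow` of negatives, a possibly divergent
`₂F₁` series) are provably irrelevant to the crux. [folklore] -/
theorem cruxWithLaw_congr {G G' : ℝ → ℝ} (h : EqOn G G' (Ioo 0 1)) : CruxWithLaw G ↔ CruxWithLaw G' := by
  simp only [CruxWithLaw, hasCrossingLimit_iff_modulus]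
  refine forall₂_congr fun R _ ↦ ?_
  rw [h (modulus_mem_Ioo R)]

/-- Any law agreeing with `cardyFunction` on `(0,1)` gives an equivalent crux. [folklore] -/
theorem cruxWithLaw_iff_of_eqOn {G : ℝ → ℝ} (h : EqOn G cardyFunction (Ioo 0 1)) :
    CruxWithLaw G ↔ RectilinearCardy :=
  cruxWithLaw_congr h

/-- **Unconditionally refuted laws**: a candidate scaling function taking a value outside `(0,1)`
somewhere on `(0,1)` cannot be the crossing law of rectilinear rectangles (RSW, §3, + rectangles
realise every modulus, §6). This is all that §3 can refute: `cardyFunction` maps `(0,1)` into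
`(0,1)` (`cardyFunction_mem_Ioo`). [folklore] -/
theorem not_cruxWithLaw_of_exists {G : ℝ → ℝ} (h : ∃ η ∈ Ioo (0 : ℝ) 1, G η ∉ Ioo (0 : ℝ) 1) :
    ¬ CruxWithLaw G := by
  rintro hG
  obtain ⟨η, hη, hGη⟩ := h
  obtain ⟨R, hR, rfl⟩ := exists_isRectilinear_modulus_eq hη
  exact hGη (limit_mem_Ioo R (hasCrossingLimit_iff_modulus.1 (hG R hR)))

/-- Example: the linear law `η ↦ 2η` is refuted outright. [folklore] -/
example : ¬ CruxWithLaw (fun η ↦ 2 * η) :=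
  not_cruxWithLaw_of_exists ⟨3 / 4, by norm_num, by norm_num⟩

/-- A law for which the crux holds agrees with `cardyFunction` on `(0,1)` as soon as the crux
itself holds (`law_eqOn`): the crux admits no competitor. [folklore] -/
theorem CruxWithLaw.eqOn_cardyFunction {G : ℝ → ℝ} (hG : CruxWithLaw G) (h : Crux) :
    EqOn G cardyFunction (Ioo 0 1) :=
  law_eqOn hG h


/-! ## §11 (cycle 2) A reflex-cornered instance in Lean: the L-shape `((0,2)² ∖ [1,2]²; 0, 2, 1+i, 2i)`

The tree's first conformal rectangle with a REFLEX corner (built on `polygonDomain`,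
`PolygonalDomains.lean`): the hexagon `0, 2, 2+i, 1+i, 1+2i, 2i` is a simple closed polygon
(`isSimpleClosedPolygon_lVerts`), `lShapeQuad` marks its vertices `0, 2, 1+i, 2i` — the reflex
corner `1 + i` IS a mark (numerics marking LA) —, its boundary is the union of the six sides
(`frontier_lShapeQuad`), so it is an instance of the crux (`isRectilinear_lShapeQuad`); the
reflection `z ↦ i z̄` preserves it (`swapH_image_carrier`, via uniqueness of the inside of a
Jordan curve), fixes `0` and `1 + i` and swaps `2 ↔ 2i`, so its modulus is `1/2`
(`crossRatio_lShapeQuad`, `modulus_lShapeQuad`) and THE CRUX PREDICTS `P → F(1/2) = 1/2`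
(`tendsto_half_lShape_of_crux`) for the crossing from the bottom side `[0,2]` to the upper-left
boundary `[1+i, 1+2i] ∪ [1+2i, 2i]` around the notch. Kill shot number three — and it misses like
the square: `P = 0.5015(8), 0.4994(11), 0.5010(12)` at `δ = 2/65, 2/129, 2/257` under the tree's
exact discretisation (§8 `numerics_evidence_cycle2_lshape`; cycle 1: `0.502–0.505 ± 0.004–0.008`).
A template for `CardyOneStep` (stmt-4783) provers: one-step polygons as `polygonDomain`s. -/

section LShape

/-- Vertices of the L-shaped hexagon `(0,2)² ∖ [1,2]²`, counterclockwise from the origin. -/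
def lVerts : List ℂ := [0, 2, 2 + I, 1 + I, 1 + 2 * I, 2 * I]

@[simp] theorem length_lVerts : lVerts.length = 6 := rfl

/-- The L-shaped hexagon is a simple closed polygon. -/
theorem isSimpleClosedPolygon_lVerts : IsSimpleClosedPolygon lVerts := by
  refine IsSimpleClosedPolygon.of_lt (by simp) ?_ ?_
  · intro k hk
    have : k < 6 := by simpa using hk
    interval_cases k <;> simp [lVerts, Complex.ext_iff]
  · intro i j hi hj hij
    have hj6 : j < 6 := by simpa using hj
    interval_cases j <;> interval_cases i <;>
    · simp only [lVerts, List.length_cons, List.length_nil, Nat.reduceAdd, Nat.reduceMod,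
        List.getElem_cons_zero, List.getElem_cons_succ, Set.disjoint_left]
      rintro _ ⟨θ, ⟨hθ0, hθ1⟩, rfl⟩ ⟨θ', ⟨hθ0', hθ1'⟩, h⟩
      have hre := congrArg Complex.re h
      have him := congrArg Complex.im h
      simp [AffineMap.lineMap_apply_module'] at hre him <;> nlinarith

/-- The L-shaped Jordan domain (inside of the hexagon). -/
def lShapeDomain : JordanDomain := polygonDomain lVerts isSimpleClosedPolygon_lVerts

/-- Boundary parameters of the marks: vertices `0, 1, 3, 5` of the hexagon, i.e. the points
`0, 2, 1 + i, 2i` (the reflex corner `1 + i` is a mark). -/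
def lMarks : Fin 4 → ℝ := ![0, 1 / 6, 3 / 6, 5 / 6]

/-- **The L-shaped conformal rectangle** `((0,2)² ∖ [1,2]²; 0, 2, 1+i, 2i)`: crossing from the
bottom side to the upper-left part of the boundary `[1+i, 1+2i] ∪ [1+2i, 2i]`. -/
def lShapeQuad : ConformalRectangle where
  toJordanDomain := lShapeDomain
  mark := lMarks
  strictMono_mark := by
    refine Fin.strictMono_iff_lt_succ.2 fun i ↦ ?_
    fin_cases i <;> simp [lMarks] <;> norm_num
  mark_mem := by
    intro i
    fin_cases i <;> simp [lMarks] <;> norm_num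

theorem lShapeQuad_boundary : lShapeQuad.boundary = polygonLoop lVerts := rfl

/-- The marked points, unfolded. -/
theorem lShapeQuad_pt_eq (i : Fin 4) : lShapeQuad.pt i = polygonLoop lVerts (lMarks i) := rfl

/-- The marked points are `0, 2, 1 + i, 2i`. -/
theorem lShapeQuad_pt :
    lShapeQuad.pt 0 = 0 ∧ lShapeQuad.pt 1 = 2 ∧ lShapeQuad.pt 2 = 1 + I ∧ lShapeQuad.pt 3 = 2 * I := by
  have h0 := polygonLoop_vertex (l := lVerts) (k := 0) (by simp)
  have h1 := polygonLoop_vertex (l := lVerts) (k := 1) (by simp)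
  have h3 := polygonLoop_vertex (l := lVerts) (k := 3) (by simp)
  have h5 := polygonLoop_vertex (l := lVerts) (k := 5) (by simp)
  simp only [length_lVerts, Nat.cast_ofNat, Nat.cast_one, CharP.cast_eq_zero, zero_div] at h0 h1 h3 h5
  simp only [lShapeQuad_pt_eq, lMarks, Matrix.cons_val_zero, Matrix.cons_val_one, Matrix.cons_val]
  refine ⟨?_, ?_, ?_, ?_⟩
  · rw [h0]; simp [lVerts]
  · rw [h1]; simp [lVerts]
  · rw [h3]; simp [lVerts]
  · rw [h5]; simp [lVerts]

/-- The boundary of the L-shape is the union of the six closed sides. -/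
theorem frontier_lShapeQuad :
    frontier lShapeQuad.carrier = segment ℝ (0 : ℂ) 2 ∪ segment ℝ (2 : ℂ) (2 + I) ∪
      segment ℝ (2 + I) (1 + I) ∪ segment ℝ (1 + I) (1 + 2 * I) ∪ segment ℝ (1 + 2 * I) (2 * I) ∪
      segment ℝ (2 * I) 0 := by
  have h := frontier_polygonDomain lVerts isSimpleClosedPolygon_lVerts
  change frontier lShapeDomain.carrier = _
  rw [show lShapeDomain = polygonDomain lVerts isSimpleClosedPolygon_lVerts from rfl, h]
  ext z
  simp only [mem_iUnion, mem_union]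
  constructor
  · rintro ⟨k, hk⟩
    fin_cases k <;> simp [lVerts] at hk <;> tauto
  · rintro (((((h | h) | h) | h) | h) | h)
    · exact ⟨⟨0, by simp⟩, by simpa [lVerts] using h⟩
    · exact ⟨⟨1, by simp⟩, by simpa [lVerts] using h⟩
    · exact ⟨⟨2, by simp⟩, by simpa [lVerts] using h⟩
    · exact ⟨⟨3, by simp⟩, by simpa [lVerts] using h⟩
    · exact ⟨⟨4, by simp⟩, by simpa [lVerts] using h⟩
    · exact ⟨⟨5, by simp⟩, by simpa [lVerts] using h⟩

/-! ### The diagonal symmetry `z ↦ i z̄` of the L-shape -/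

/-- The reflection in the diagonal `y = x`, `z ↦ i z̄` (`= antiAffine I 0`), as an `ℝ`-linear map. -/
def swapL : ℂ →ₗ[ℝ] ℂ where
  toFun z := I * conj z
  map_add' z w := by simp only [map_add, mul_add]
  map_smul' r z := by
    apply Complex.ext <;> simp

@[simp] theorem swapL_apply (z : ℂ) : swapL z = I * conj z := rfl

theorem swapL_swapL (z : ℂ) : swapL (swapL z) = z := by
  apply Complex.ext <;> simp

/-- The reflection as a homeomorphism of the plane. -/
def swapH : ℂ ≃ₜ ℂ where
  toFun := swapL
  invFun := swapL
  left_inv := swapL_swapL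
  right_inv := swapL_swapL
  continuous_toFun := by
    show Continuous fun z : ℂ ↦ I * conj z
    fun_prop
  continuous_invFun := by
    show Continuous fun z : ℂ ↦ I * conj z
    fun_prop

@[simp] theorem swapH_apply (z : ℂ) : swapH z = I * conj z := rfl

theorem antiAffine_I_zero (z : ℂ) : antiAffine I 0 z = swapH z := by simp

theorem swapL_image_segment (a b : ℂ) : swapL '' segment ℝ a b = segment ℝ (swapL a) (swapL b) := by
  have := image_segment ℝ swapL.toAffineMap a b
  simpa using this

/-- The reflection preserves the boundary hexagon. -/
theorem swapH_image_frontier : swapH '' frontier lShapeQuad.carrier = frontier lShapeQuad.carrier := by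
  have hcoe : (swapH : ℂ → ℂ) = swapL := rfl
  rw [frontier_lShapeQuad, hcoe]
  simp only [image_union, swapL_image_segment]
  have e0 : swapL 0 = 0 := by apply Complex.ext <;> simp
  have e1 : swapL 2 = 2 * I := by apply Complex.ext <;> simp
  have e2 : swapL (2 + I) = 1 + 2 * I := by apply Complex.ext <;> simp
  have e3 : swapL (1 + I) = 1 + I := by apply Complex.ext <;> simp
  have e4 : swapL (1 + 2 * I) = 2 + I := by apply Complex.ext <;> simp
  have e5 : swapL (2 * I) = 2 := by apply Complex.ext <;> simp
  rw [e0, e1, e2, e3, e4, e5]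
  ext z
  simp only [mem_union, segment_symm ℝ (2 * I) 0, segment_symm ℝ (1 + 2 * I) (2 * I),
    segment_symm ℝ (1 + I) (1 + 2 * I), segment_symm ℝ (2 + I) (1 + I), segment_symm ℝ (2 : ℂ) (2 + I),
    segment_symm ℝ (0 : ℂ) 2]
  tauto

/-- The reflection maps the L-shape onto itself (the inside of a Jordan curve is determined by the
curve, `JordanDomain.carrier_eq_of_frontier_eq`). -/
theorem swapH_image_carrier : swapH '' lShapeQuad.carrier = lShapeQuad.carrier := by
  have h : frontier (lShapeQuad.toJordanDomain.map swapH).carrier = frontier lShapeQuad.carrier := by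
    rw [JordanDomain.carrier_map, ← swapH.image_frontier, swapH_image_frontier]
  exact JordanDomain.carrier_eq_of_frontier_eq h

theorem mapsTo_swap : MapsTo (antiAffine I 0) lShapeQuad.carrier lShapeQuad.carrier := by
  intro z hz
  rw [antiAffine_I_zero, ← swapH_image_carrier]
  exact mem_image_of_mem _ hz

/-- **The L-shape `((0,2)² ∖ [1,2]²; 0, 2, 1+i, 2i)` has conformal modulus `1/2`** for every
uniformizing datum: the reflection `z ↦ i z̄` preserves the domain, fixes the marks `0` and
`1 + i` (the reflex corner) and swaps `2 ↔ 2i` (tree symmetry principle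
`ConformalRectangle.crossRatio_eq_half_of_antiAffine`). -/
theorem crossRatio_lShapeQuad {φ : ConformalEquiv UpperHalfPlane.upperHalfPlaneSet lShapeQuad.carrier}
    {x : Fin 4 → ℝ} (h : lShapeQuad.IsUniformizing φ x) : crossRatio x = 1 / 2 := by
  obtain ⟨h0, h1, h2, h3⟩ := lShapeQuad_pt
  refine ConformalRectangle.crossRatio_eq_half_of_antiAffine lShapeQuad (u := I) (v := 0)
    (by simp) (by simp) mapsTo_swap ?_ ?_ ?_ h
  · rw [h0]; simp
  · rw [h2]; apply Complex.ext <;> simp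
  · rw [h1, h3]; apply Complex.ext <;> simp


/-- The L-shape is an instance of the crux (its boundary lies in six axis-parallel segments). [folklore] -/
theorem isRectilinear_lShapeQuad : IsRectilinear lShapeQuad := by
  classical
  refine ⟨{((0 : ℂ), (2 : ℂ)), ((2 : ℂ), 2 + I), (2 + I, 1 + I), (1 + I, 1 + 2 * I),
    (1 + 2 * I, 2 * I), (2 * I, (0 : ℂ))}, ?_, ?_⟩
  · intro p hp
    simp only [Finset.mem_insert, Finset.mem_singleton] at hp
    rcases hp with rfl | rfl | rfl | rfl | rfl | rfl <;> simp
  · rw [frontier_lShapeQuad]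
    intro z hz
    simp only [mem_iUnion, Finset.mem_insert, Finset.mem_singleton, exists_prop]
    rcases hz with (((((h | h) | h) | h) | h) | h)
    · exact ⟨_, Or.inl rfl, h⟩
    · exact ⟨_, Or.inr (Or.inl rfl), h⟩
    · exact ⟨_, Or.inr (Or.inr (Or.inl rfl)), h⟩
    · exact ⟨_, Or.inr (Or.inr (Or.inr (Or.inl rfl))), h⟩
    · exact ⟨_, Or.inr (Or.inr (Or.inr (Or.inr (Or.inl rfl)))), h⟩
    · exact ⟨_, Or.inr (Or.inr (Or.inr (Or.inr (Or.inr rfl)))), h⟩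

/-- The modulus of the L-shape `((0,2)² ∖ [1,2]²; 0, 2, 1+i, 2i)` is `1/2`. [folklore] -/
theorem modulus_lShapeQuad : modulus lShapeQuad = 1 / 2 :=
  (crossRatio_eq_modulus (isUniformizing_modulusDatum lShapeQuad)).symm.trans
    (crossRatio_lShapeQuad (isUniformizing_modulusDatum lShapeQuad))

/-- **Crux ⇒ the L-shape with a mark at its reflex corner is crossed with probability `→ 1/2`**
(bottom side ↔ upper-left boundary around the notch). True numerically to `0.1 %` (§8), so this
kill shot misses too; recorded as the reflex-corner analogue of `SquareCrossingHalf`. [folklore] -/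
theorem tendsto_half_lShape_of_crux (h : Crux) :
    Tendsto (bondDomainCrossingProb lShapeQuad) (𝓝[>] 0) (𝓝 (1 / 2)) := by
  have := hasCrossingLimit_iff_modulus.1 (h lShapeQuad isRectilinear_lShapeQuad)
  rwa [modulus_lShapeQuad, cardyFunction_half] at this

end LShape

end Summit.CriticalPhenomena.CardyFormulaZ2.Cruxes.RectilinearCardy.Disproof

end
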